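import Literature.Analysis.PDE.LoewnerNirenberg
import Literature.Analysis.PDE.HopfLemmas
import Literature.Analysis.FunctionSpaces.BallLipschitzDomain
import Mathlib.Geometry.Euclidean.Inversion.Basic
import Mathlib.Analysis.SpecialFunctions.Pow.Asymptotics
import Mathlib.Analysis.SpecialFunctions.Pow.Continuity
import Mathlib.Analysis.Convex.Basic
import Mathlib.Analysis.Calculus.FDeriv.Equiv
import Mathlib.Data.Real.Pointwise
import HarnessLib

/-!
# Loewner–Nirenberg theory: named facts and their consequences for `loewnerNirenberg Ω`

Named facts (`def … : Prop`, each a published statement, hypotheses complete) about the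
Loewner–Nirenberg equation `Δu = ¼ n(n-2) u^{(n+2)/(n-2)}` on domains of an `n`-dimensional real
inner product space `E` (`n = finrank ℝ E ≥ 3`), requested with `defn-loewnerNirenberg` by route
CriticalPhenomena/BallOrbitComparison (items `OnePointLaw`, `OrbitInversionRatio`, card
ball-orbit-loewner-nirenberg-comparison), on top of the definitions of
`Literature/Analysis/PDE/LoewnerNirenberg.lean` (`IsSolution`, `IsLargeSolution`,
`IsMaximalSolution`, `loewnerNirenberg Ω = u_Ω`, `ballProfile`), together with the consequences
for `u_Ω` PROVED from them:

* `exists_isMaximalSolution` (F1; Loewner–Nirenberg 1974, González–Li–Nguyen 2018 Def. 4.1 and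
  the paragraph following it): every open `Ω` with `ℝⁿ ∖ Ω̄ ≠ ∅` carries a maximal solution, and
  it is positive.  ⟹ `isMaximalSolution_loewnerNirenberg`, `loewnerNirenberg_pos`,
  `bddAbove_valuesAt_of_fact`, **`loewnerNirenberg_antitone`** (LN3: `Ω ⊆ Ω' → u_Ω' ≤ u_Ω` on
  `Ω`), **`IsSubsolution`-free comparison `IsSolution.le_loewnerNirenberg'`**.
* Han–Shen 2020, Thm. 2.1 — "a bounded Lipschitz domain carries exactly one positive solution with
  `u = ∞` on `∂Ω`, and it is `C^∞`", quoted there as "a well-known result" (Loewner–Nirenberg 1974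
  for `C²` domains) — is NO LONGER a named fact here (it was F2 `existsUnique_isLargeSolution`,
  whose proof is a semilinear elliptic existence and regularity theory; it was minted for LN1 and
  LN4-ball, which do not need it).  See `LoewnerNirenbergLargeSolution.lean`, where, on top of the
  comparison principle of `LoewnerNirenbergMaximal.lean`, the following are PROVED without any
  fact: Thm. 2.1 ON BALLS (`IsLargeSolution.eqOn_ballProfile`: every large solution of a ball is
  the Poincaré profile; `loewnerNirenberg_ball_eq`: LN4, `u_{B(c,R)} = (2R/(R²-|x-c|²))^{(n-2)/2}`,
  in dimension three `√(2R/(R²-|x-c|²))`, `loewnerNirenberg_ball_eq_sqrt`), the existence half of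
  Thm. 2.1 given the maximal solution (`IsMaximalSolution.isLargeSolution`,
  `tendsto_loewnerNirenberg_atTop`: `u_Ω = ∞` on `∂Ω` for every Lipschitz `Ω`; LN1 under F1 alone:
  `isLargeSolution_loewnerNirenberg_of_isLipschitzDomain`), and the Loewner–Nirenberg uniqueness
  mechanism `IsSolution.le_of_frontier_ratio` (`u ≤ v` on a bounded `Ω` as soon as
  `u ≤ (1+ε)v` near `∂Ω` for every `ε > 0`).  Kept in this file: the profile is a positive large
  solution of the ball (`isLargeSolution_ballProfile`).
* `boundary_asymptotics` (F3; Loewner–Nirenberg 1974 as restated in Han–Shen 2020, (1.3) and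
  Thm. 3.1 with `α = 1`): on a bounded `C²` domain, `|d^{(n-2)/2} u - 1| ≤ C d` near `∂Ω`.
  ⟹ `tendsto_boundary_asymptotics` (LN1: `d(x)^{(n-2)/2} u(x) → 1`).
* `isSolution_kelvinTransform` (F4; the conformal invariance of the equation under inversions,
  Loewner–Nirenberg 1974 — title result; González–Li–Nguyen 2018, §2.2 "by conformal invariance"
  for the Kelvin transform `u_{x,λ}(y) = (λ/|y-x|)^{n-2} u(x + λ²(y-x)/|y-x|²)`).
  ⟹ **`loewnerNirenberg_inversion`** (LN2: `u_{ι(Ω)}(ι x) · (r²/|x-a|²)^{(n-2)/2} = u_Ω(x)` for the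
  inversion `ι` in the sphere `S(a,r)` with pole `a ∉ Ω`).
* `halfSpace_unique` (F5; Duncan–Nguyen 2025, Cor. 1.4, after Han–Shen 2020): on an open
  half-space `H`, `dist(x,∂H)^{-(n-2)/2}` is the unique positive solution with `u = ∞` on `∂H`.
  ⟹ **`loewnerNirenberg_halfSpace`** (LN4: `u_H(x) = dist(x,∂H)^{-(n-2)/2}`).
* `punctured_space_liouville` (F6; González–Li–Nguyen 2018, §1 p. 4 with footnote, for the
  Loewner–Nirenberg cone `Γ₁`): on `ℝⁿ ∖ {a}` the maximal solution vanishes identically.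
  ⟹ `loewnerNirenberg_compl_singleton`, `loewnerNirenberg_univ` (LN4: `u ≡ 0` on the punctured and
  the whole space — a point is a removable boundary portion, of Hausdorff dimension `0 < (n-2)/2`).
  **F6 is PROVED here** (`punctured_space_liouville_holds`, whence the unconditional
  `loewnerNirenberg_compl_singleton'`, `loewnerNirenberg_univ'`): the classical second-order
  condition `Δw ≤ 0` at a local maximum (`laplacian_nonpos_of_isLocalMax`), the comparison with
  the ball solution `u ≤ u_{R,c}` on `B(c,R) ⋐ Ω` (`IsSolution.le_ballProfile`, the comparison
  principle behind González–Li–Nguyen 2018, Lemma 3.1), the a-priori bound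
  `u(x) ≤ 4^{(n-2)/2}|x-a|^{-(n-2)/2}` (`IsSolution.le_of_compl_singleton`, ibid. Lemma 3.1), the
  harmonicity of `|x-a|^{2-n}` (`laplacian_fundamental_eq_zero`), and the footnote's maximum
  principle made quantitative with the barrier `ε|x-a|^{2-n} + δ` on annuli.

## Design notes

* Every fact is parametrised by the ambient space `E` (section variable) and carries the
  dimension hypothesis `3 ≤ finrank ℝ E` inside; domains with boundary regularity are
  `Ω : TopologicalSpace.Opens E` with the tree's `IsLipschitzDomain` / `IsContDiffDomain 2`
  (`Literature/Analysis/FunctionSpaces/SobolevTrace.lean`); "domain" = open and connected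
  (`IsConnected`), as in the sources.  "`u = ∞` on `∂Ω`" is `IsLargeSolution` (blow-up at every
  point of `frontier Ω` within `Ω`), equivalent for bounded `Ω` to `u(x) → ∞` as `dist(x,∂Ω) → 0`.
* Faithfulness: F3 asks `u ∈ C^∞(Ω)` as Han–Shen's Thm. 3.1 does; F5
  is stated for classical solutions, which are continuous viscosity solutions, so it is implied by
  the printed classification; F6 is the printed `u_Ω ≡ 0` for `Ω = ℝⁿ ∖ {0}` with `u_Ω` the
  maximal solution (domination of every solution by the exhaustion limit, ibid. §4).
* What is NOT here: the UNIQUENESS of the large solution on a general bounded Lipschitz domain and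
  its interior `C^∞` regularity (Han–Shen 2020, Thm. 2.1, quoted there without proof;
  Loewner–Nirenberg 1974 for `C²` domains, Marcus–Véron 1997 for singular domains as cited there):
  no item uses it, and `IsSolution.eqOn_of_frontier_ratio` (`LoewnerNirenbergLargeSolution.lean`)
  reduces it to the boundary ratio `u/v → 1`, available on balls and, via F3, on `C²` domains.
  Also not here: the exterior-of-ball value `(2R/(|x-c|²-R²))^{(n-2)/2}` as the MAXIMAL solution
  (Han–Shen 2020, (2.2) prints only that it is a large solution — PROVED here:
  `isLargeSolution_exteriorProfile`, whence `exteriorProfile_le_loewnerNirenberg` under F1; its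
  maximality needs the removability of an isolated singularity, Brezis–Véron 1980, not vendored),
  removability of
  boundary portions of Hausdorff dimension `< (n-2)/2` in general and blow-up along submanifolds of
  dimension `> (n-2)/2` (Loewner–Nirenberg 1974; theorem numbers pending acquisition acq-02662 of
  the paywalled original), and the comparison of SUBsolutions with `u_Ω` (the route's foreseen
  "comparison engine"; it is the maximum-principle argument of González–Li–Nguyen 2018, §4.1, to
  be filed with that item).
* PROVED unconditionally (no facts): the SIMILARITY covariance `u_{φΩ}(φx) μ^{(n-2)/2} = u_Ω(x)`
  for `φ x = c + μ R x` (`loewnerNirenberg_similarity`, `_translate`, `_dilate`,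
  `_linearIsometryEquiv`) — the solution sets correspond exactly (`IsSolution.comp_similarity`,
  `valuesAt_similarity`), so the suprema scale (`Real.sSup_smul_of_nonneg`).

## References

* C. Loewner, L. Nirenberg, *Partial differential equations invariant under conformal or
  projective transformations*, Contributions to Analysis, Academic Press (1974), 245–272.
  [LoewnerNirenberg1974] (paywalled; acquisition acq-02662)
* Q. Han, W. Shen, *The Loewner–Nirenberg problem in singular domains*, J. Funct. Anal. 279
  (2020) 108604, arXiv:1511.01146: (1.1)–(1.3), (2.1)–(2.2), Thm. 2.1, Thm. 3.1. [HanShen2020]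
* M. d. M. González, Y. Y. Li, L. Nguyen, *Existence and uniqueness to a fully nonlinear version
  of the Loewner–Nirenberg problem*, Commun. Math. Stat. 6 (2018) 269–288, arXiv:1804.08851: §1
  (p. 4), §2.2, Def. 4.1, Lemma 4.2. [GonzalezLiNguyen2018]
* J. A. J. Duncan, L. Nguyen, *The fully nonlinear Loewner–Nirenberg problem: Liouville theorems
  and counterexamples to local boundary estimates*, Anal. PDE 18 (2025), arXiv:2507.16383,
  (1.3) = (303) and Cor. 1.4. [DuncanNguyen2025]
-/

noncomputable section

open Set Filter Metric Module TopologicalSpace Bornology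
open scoped Laplacian Topology ContDiff

namespace Literature.Analysis.PDE

namespace LoewnerNirenberg

open Literature.Analysis.FunctionSpaces (IsLipschitzDomain IsContDiffDomain isLipschitzDomain_ball)

variable {E : Type*} [NormedAddCommGroup E] [InnerProductSpace ℝ E] [FiniteDimensional ℝ E]

/-! ### F1. The maximal solution -/

/-- **F1 (Loewner–Nirenberg; maximal solution).** Let `n ≥ 3` and let `Ω ⊆ ℝⁿ` be open with
`ℝⁿ ∖ Ω̄ ≠ ∅` be a domain (connected). Then the Loewner–Nirenberg equation has a MAXIMAL solution
on `Ω` — a solution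
`u_Ω` with `v ≤ u_Ω` on `Ω` for every solution `v` on `Ω` — and `u_Ω > 0` on `Ω`
(González–Li–Nguyen 2018, Def. 4.1 and the following paragraph: "`u_Ω = lim u_j` [the decreasing
limit of the large solutions of smooth bounded `Ω_j ⋐ Ω` exhausting `Ω`, cf. Loewner–Nirenberg]
… If `u_Ω > 0` (which is the case if e.g. `ℝⁿ ∖ Ω̄ ≠ ∅` …), it is the maximal positive solution";
ibid. §1 p. 4). [cite: GonzalezLiNguyen2018, Def. 4.1 and §1 (following LoewnerNirenberg1974)] -/
def exists_isMaximalSolution : Prop :=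
  ∀ ⦃Ω : Set E⦄, 3 ≤ finrank ℝ E → IsOpen Ω → IsConnected Ω → (closure Ω)ᶜ.Nonempty →
    ∃ u : E → ℝ, IsMaximalSolution Ω u ∧ ∀ x ∈ Ω, 0 < u x

section MaximalConsequences

variable {Ω Ω' : Set E} {x : E}

/-- Under F1, `u_Ω` is the maximal solution of every open `Ω` with `ℝⁿ ∖ Ω̄ ≠ ∅`. [folklore] -/
theorem isMaximalSolution_loewnerNirenberg (h : exists_isMaximalSolution (E := E))
    (hn : 3 ≤ finrank ℝ E) (hΩ : IsOpen Ω) (hconn : IsConnected Ω) (hc : (closure Ω)ᶜ.Nonempty) :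
    IsMaximalSolution Ω (loewnerNirenberg Ω) := by
  obtain ⟨u, hu, -⟩ := h hn hΩ hconn hc
  exact hu.loewnerNirenberg hΩ

/-- Under F1, `u_Ω > 0` on `Ω`. [folklore] -/
theorem loewnerNirenberg_pos (h : exists_isMaximalSolution (E := E)) (hn : 3 ≤ finrank ℝ E)
    (hΩ : IsOpen Ω) (hconn : IsConnected Ω) (hc : (closure Ω)ᶜ.Nonempty) (hx : x ∈ Ω) :
    0 < loewnerNirenberg Ω x := by
  obtain ⟨u, hu, hpos⟩ := h hn hΩ hconn hc
  rw [hu.eqOn_loewnerNirenberg hx]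
  exact hpos x hx

/-- Under F1, the values of solutions at a point of `Ω` are bounded. [folklore] -/
theorem bddAbove_valuesAt_of_fact (h : exists_isMaximalSolution (E := E)) (hn : 3 ≤ finrank ℝ E)
    (hΩ : IsOpen Ω) (hconn : IsConnected Ω) (hc : (closure Ω)ᶜ.Nonempty) (hx : x ∈ Ω) :
    BddAbove (valuesAt Ω x) := by
  obtain ⟨u, hu, -⟩ := h hn hΩ hconn hc
  exact bddAbove_valuesAt fun v hv => hu.le hv hx

/-- Under F1, every solution lies below `u_Ω` on `Ω` (maximality). [folklore] -/
theorem IsSolution.le_loewnerNirenberg' (h : exists_isMaximalSolution (E := E))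
    (hn : 3 ≤ finrank ℝ E) (hΩ : IsOpen Ω) (hconn : IsConnected Ω) (hc : (closure Ω)ᶜ.Nonempty)
    {v : E → ℝ} (hv : IsSolution Ω v) (hx : x ∈ Ω) : v x ≤ loewnerNirenberg Ω x :=
  hv.le_loewnerNirenberg hx (bddAbove_valuesAt_of_fact h hn hΩ hconn hc hx)

/-- **LN3 — antitonicity of `Ω ↦ u_Ω`** (under F1): if `Ω ⊆ Ω'`, `Ω` open with `ℝⁿ ∖ Ω̄ ≠ ∅`,
then `u_Ω' ≤ u_Ω` on `Ω` (González–Li–Nguyen 2018, after Def. 4.1: "if `Ω ⊂ Ω̃`, then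
`u_Ω ≥ u_Ω̃` in `Ω`"). [cite: GonzalezLiNguyen2018, §4 after Def. 4.1] -/
theorem loewnerNirenberg_antitone (h : exists_isMaximalSolution (E := E)) (hn : 3 ≤ finrank ℝ E)
    (hΩ : IsOpen Ω) (hconn : IsConnected Ω) (hc : (closure Ω)ᶜ.Nonempty) (hsub : Ω ⊆ Ω')
    (hx : x ∈ Ω) : loewnerNirenberg Ω' x ≤ loewnerNirenberg Ω x :=
  loewnerNirenberg_anti hsub hx (bddAbove_valuesAt_of_fact h hn hΩ hconn hc hx)

end MaximalConsequences

/-! ### Large solutions: elementary lemmas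

Han–Shen 2020, Thm. 2.1 itself — formerly the named fact F2 `existsUnique_isLargeSolution` — is
treated in `LoewnerNirenbergLargeSolution.lean`: proved on balls, existence half proved on
Lipschitz domains given the maximal solution, uniqueness reduced to the boundary ratio. -/

omit [InnerProductSpace ℝ E] [FiniteDimensional ℝ E] in
/-- A bounded set in a nontrivial real normed space misses some point of the space together with
its closure. [folklore] -/
theorem exists_notMem_closure_of_isBounded [NormedSpace ℝ E] [Nontrivial E] {Ω : Set E}
    (hb : IsBounded Ω) : (closure Ω)ᶜ.Nonempty := by
  obtain ⟨r, hr⟩ := hb.closure.subset_closedBall (0 : E)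
  obtain ⟨x, hx⟩ := NormedSpace.exists_lt_norm ℝ E r
  refine ⟨x, fun hx' => ?_⟩
  have := hr hx'
  rw [mem_closedBall, dist_zero_right] at this
  linarith

omit [FiniteDimensional ℝ E] in
/-- `finrank ℝ E ≥ 3` makes `E` nontrivial. [folklore] -/
theorem nontrivial_of_three_le_finrank (hn : 3 ≤ finrank ℝ E) : Nontrivial E :=
  Module.nontrivial_of_finrank_pos (R := ℝ) (by omega)

/-- Blow-up at the boundary passes to larger functions. [folklore] -/
theorem IsLargeSolution.of_le {Ω : Set E} {u v : E → ℝ} (hu : IsLargeSolution Ω u)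
    (hv : IsSolution Ω v) (hle : ∀ x ∈ Ω, u x ≤ v x) : IsLargeSolution Ω v where
  toIsSolution := hv
  tendsto_atTop := fun z hz =>
    tendsto_atTop_mono' (𝓝[Ω] z)
      (eventually_mem_nhdsWithin.mono fun x hx => hle x hx) (hu.tendsto_atTop hz)

/-! ### LN4 (ball): the profile is a large solution (`u_{B(c,R)} = u_{R,c}` and the uniqueness of
the large solution of a ball are proved in `LoewnerNirenbergLargeSolution.lean`) -/

omit [FiniteDimensional ℝ E] in
/-- The Poincaré-ball profile tends to `+∞` at the sphere (within the ball), for `n ≥ 3`.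
[folklore] -/
theorem tendsto_ballProfile_atTop (hn : 3 ≤ finrank ℝ E) (c : E) {R : ℝ} (hR : 0 < R) {z : E}
    (hz : z ∈ frontier (ball c R)) : Tendsto (ballProfile c R) (𝓝[ball c R] z) atTop := by
  rw [frontier_ball c hR.ne', mem_sphere_iff_norm] at hz
  have hk : 0 < ((finrank ℝ E : ℝ) - 2) / 2 := by
    have : (3 : ℝ) ≤ finrank ℝ E := by exact_mod_cast hn
    linarith
  -- the denominator tends to `0` from the right within the ball
  have hden : Tendsto (fun x : E => R ^ 2 - ‖x - c‖ ^ 2) (𝓝[ball c R] z) (𝓝[>] 0) := by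
    refine tendsto_nhdsWithin_iff.2 ⟨?_, ?_⟩
    · have hcont : Continuous fun x : E => R ^ 2 - ‖x - c‖ ^ 2 := by fun_prop
      have h0 : R ^ 2 - ‖z - c‖ ^ 2 = 0 := by rw [hz]; ring
      simpa [h0] using (hcont.tendsto z).mono_left nhdsWithin_le_nhds
    · exact eventually_mem_nhdsWithin.mono fun x hx => by
        have h := norm_sub_sq_lt_of_mem_ball hx
        show 0 < R ^ 2 - ‖x - c‖ ^ 2
        linarith
  have hbase : Tendsto (fun x : E => 2 * R / (R ^ 2 - ‖x - c‖ ^ 2)) (𝓝[ball c R] z) atTop := by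
    simp only [div_eq_mul_inv]
    exact (tendsto_inv_nhdsGT_zero.comp hden).const_mul_atTop (by linarith)
  exact (tendsto_rpow_atTop hk).comp hbase

/-- The Poincaré-ball profile is a positive large solution of the ball, `n ≥ 3` (Han–Shen 2020,
(2.1): "`u_{r,x₀}` is a solution of (1.1)–(1.2) in `Ω = B_r(x₀)`"). [cite: HanShen2020, (2.1)] -/
theorem isLargeSolution_ballProfile (hn : 3 ≤ finrank ℝ E) (c : E) {R : ℝ} (hR : 0 < R) :
    IsLargeSolution (ball c R) (ballProfile c R) where
  toIsSolution := isSolution_ballProfile c hR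
  tendsto_atTop := fun _ hz => tendsto_ballProfile_atTop hn c hR hz

/-! ### LN4 (exterior of a ball). The profile `(2R/(|x-c|² - R²))^{(n-2)/2}` -/

/-- The EXTERIOR PROFILE `v_{R,c}(x) = (2R / (‖x - c‖² - R²))^{(n-2)/2}` on `ℝⁿ ∖ B̄(c,R)`
(Han–Shen 2020, (2.2); the image of the Poincaré-ball factor under the inversion in `S(c,R)`;
junk inside the closed ball). [cite: HanShen2020, (2.2)] -/
def exteriorProfile (c : E) (R : ℝ) (x : E) : ℝ :=
  (2 * R / (‖x - c‖ ^ 2 - R ^ 2)) ^ (((finrank ℝ E : ℝ) - 2) / 2)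

omit [InnerProductSpace ℝ E] [FiniteDimensional ℝ E] in
/-- Outside the closed ball, `R² < ‖x - c‖²`. [folklore] -/
theorem sq_lt_norm_sub_sq_of_mem_compl_closedBall {c : E} {R : ℝ} (hR : 0 < R) {x : E}
    (hx : x ∈ (closedBall c R)ᶜ) : R ^ 2 < ‖x - c‖ ^ 2 := by
  rw [mem_compl_iff, mem_closedBall, dist_eq_norm, not_le] at hx
  exact pow_lt_pow_left₀ hx hR.le two_ne_zero

omit [FiniteDimensional ℝ E] in
/-- The exterior profile is positive outside the closed ball. [folklore] -/
theorem exteriorProfile_pos {c : E} {R : ℝ} (hR : 0 < R) {x : E} (hx : x ∈ (closedBall c R)ᶜ) :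
    0 < exteriorProfile c R x := by
  have h := sq_lt_norm_sub_sq_of_mem_compl_closedBall hR hx
  exact Real.rpow_pos_of_pos (div_pos (by linarith) (by linarith)) _

omit [FiniteDimensional ℝ E] in
/-- The exterior profile is `C²` (indeed smooth) outside the closed ball. [folklore] -/
theorem contDiffOn_exteriorProfile (c : E) {R : ℝ} (hR : 0 < R) :
    ContDiffOn ℝ 2 (exteriorProfile c R) (closedBall c R)ᶜ := by
  intro x hx
  have h := sq_lt_norm_sub_sq_of_mem_compl_closedBall hR hx
  have h1 : ContDiffAt ℝ 2 (fun y : E => 2 * R / (‖y - c‖ ^ 2 - R ^ 2)) x := by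
    refine contDiffAt_const.div (ContDiffAt.sub ?_ contDiffAt_const) (by linarith)
    exact ((contDiff_norm_sq ℝ).comp (contDiff_id.sub contDiff_const)).contDiffAt
  exact (h1.rpow_const_of_ne (div_pos (by linarith) (by linarith)).ne').contDiffWithinAt

/-- `d/dσ (σ - R²)^p = p (σ - R²)^{p-1}` for `R² < σ` (with the exponent `q = p - 1` of the
derivative as a separate argument). [folklore] -/
theorem hasDerivAt_sub_sq_rpow (R p q : ℝ) (hq : q = p - 1) {σ : ℝ} (hσ : R ^ 2 < σ) :
    HasDerivAt (fun τ : ℝ => (τ - R ^ 2) ^ p) (p * (σ - R ^ 2) ^ q) σ := by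
  subst hq
  have h : HasDerivAt (fun τ : ℝ => τ - R ^ 2) (1 - 0) σ :=
    (hasDerivAt_id σ).sub (hasDerivAt_const σ (R ^ 2))
  have hne : σ - R ^ 2 ≠ 0 := by linarith
  exact (h.rpow_const (p := p) (Or.inl hne)).congr_deriv (by ring)

/-- **The exterior profile solves the Loewner–Nirenberg equation** on `ℝⁿ ∖ B̄(c,R)`, `R > 0`
(Han–Shen 2020, after (2.2): "`v_{r,x₀}` is a solution of (1.1)–(1.2) in `Ω = ℝⁿ ∖ B_r(x₀)`"; the
same radial computation as for the ball with `t = |x-c|² - R²`). [cite: HanShen2020, (2.2)] -/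
theorem isSolution_exteriorProfile (c : E) {R : ℝ} (hR : 0 < R) :
    IsSolution (closedBall c R)ᶜ (exteriorProfile c R) := by
  obtain ⟨k, hk⟩ : ∃ k : ℝ, ((finrank ℝ E : ℝ) - 2) / 2 = k := ⟨_, rfl⟩
  obtain ⟨A, hA⟩ : ∃ A : ℝ, 2 * R = A := ⟨_, rfl⟩
  have hA0 : 0 < A := by rw [← hA]; positivity
  have hprof : exteriorProfile c R = fun y => (A / (‖y - c‖ ^ 2 - R ^ 2)) ^ k := by
    funext y
    simp only [exteriorProfile, hk, hA]
  have hgG : ∀ τ : ℝ, R ^ 2 < τ → (A / (τ - R ^ 2)) ^ k = A ^ k * (τ - R ^ 2) ^ (-k) := by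
    intro τ hτ
    have ht : 0 < τ - R ^ 2 := by linarith
    rw [Real.div_rpow hA0.le ht.le, Real.rpow_neg ht.le, div_eq_mul_inv]
  have hgd : ∀ σ ∈ Ioi (R ^ 2),
      HasDerivAt (fun τ : ℝ => (A / (τ - R ^ 2)) ^ k) (-(A ^ k * k) * (σ - R ^ 2) ^ (-k - 1)) σ := by
    intro σ hσ
    have hσ' : R ^ 2 < σ := hσ
    have h : HasDerivAt (fun τ : ℝ => A ^ k * (τ - R ^ 2) ^ (-k))
        (-(A ^ k * k) * (σ - R ^ 2) ^ (-k - 1)) σ :=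
      ((hasDerivAt_sub_sq_rpow R (-k) (-k - 1) (by ring) hσ').const_mul (A ^ k)).congr_deriv
        (by ring)
    refine h.congr_of_eventuallyEq ?_
    filter_upwards [isOpen_Ioi.mem_nhds hσ] with τ hτ using hgG τ hτ
  have hg₁d : ∀ σ : ℝ, R ^ 2 < σ → HasDerivAt (fun τ : ℝ => -(A ^ k * k) * (τ - R ^ 2) ^ (-k - 1))
      (A ^ k * k * (k + 1) * (σ - R ^ 2) ^ (-k - 2)) σ := fun σ hσ =>
    ((hasDerivAt_sub_sq_rpow R (-k - 1) (-k - 2) (by ring) hσ).const_mul (-(A ^ k * k))).congr_deriv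
      (by ring)
  refine ⟨contDiffOn_exteriorProfile c hR, fun x hx => (exteriorProfile_pos hR hx).le,
    fun x hx => ?_⟩
  have hs : R ^ 2 < ‖x - c‖ ^ 2 := sq_lt_norm_sub_sq_of_mem_compl_closedBall hR hx
  have ht : 0 < ‖x - c‖ ^ 2 - R ^ 2 := by linarith
  have hΔ : (Δ (exteriorProfile c R)) x =
      4 * (A ^ k * k * (k + 1) * (‖x - c‖ ^ 2 - R ^ 2) ^ (-k - 2)) * ‖x - c‖ ^ 2
        + 2 * (finrank ℝ E : ℝ) * (-(A ^ k * k) * (‖x - c‖ ^ 2 - R ^ 2) ^ (-k - 1)) := by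
    have h1 := laplacian_translate_sub (fun w : E => (A / (‖w‖ ^ 2 - R ^ 2)) ^ k) c x
    have h2 := Literature.Analysis.FluidPDE.laplacian_comp_norm_sq (E := E) isOpen_Ioi hgd hs
      (hg₁d _ hs)
    rw [hprof]
    exact h1.trans h2
  have hval : exteriorProfile c R x = A ^ k * (‖x - c‖ ^ 2 - R ^ 2) ^ (-k) := by
    rw [hprof]
    exact hgG _ hs
  rw [hΔ, hval]
  simp only [nonlinearity, coeff, exponent]
  rcases eq_or_ne ((finrank ℝ E : ℝ) - 2) 0 with h2 | h2
  · have hk0 : k = 0 := by rw [← hk, h2]; simp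
    rw [hk0, h2]
    simp
  · have hkp : k * ((((finrank ℝ E : ℕ) : ℝ) + 2) / (((finrank ℝ E : ℕ) : ℝ) - 2)) = k + 2 := by
      rw [← hk]
      field_simp
      ring
    have hAk : 0 ≤ A ^ k := Real.rpow_nonneg hA0.le _
    have htk : 0 ≤ (‖x - c‖ ^ 2 - R ^ 2) ^ (-k) := Real.rpow_nonneg ht.le _
    rw [Real.mul_rpow hAk htk, ← Real.rpow_mul hA0.le, ← Real.rpow_mul ht.le,
      show -k * ((((finrank ℝ E : ℕ) : ℝ) + 2) / (((finrank ℝ E : ℕ) : ℝ) - 2))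
        = -(k * ((((finrank ℝ E : ℕ) : ℝ) + 2) / (((finrank ℝ E : ℕ) : ℝ) - 2))) by ring,
      hkp, Real.rpow_add hA0, show (-(k + 2) : ℝ) = -k - 2 by ring,
      show (-k - 1 : ℝ) = (-k - 2) + 1 by ring, Real.rpow_add ht, Real.rpow_one, Real.rpow_two,
      ← hk, ← hA]
    ring

omit [FiniteDimensional ℝ E] in
/-- The exterior profile tends to `+∞` at the sphere from outside, `n ≥ 3`. [folklore] -/
theorem tendsto_exteriorProfile_atTop (hn : 3 ≤ finrank ℝ E) (c : E) {R : ℝ} (hR : 0 < R)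
    {z : E} (hz : z ∈ frontier (closedBall c R)ᶜ) :
    Tendsto (exteriorProfile c R) (𝓝[(closedBall c R)ᶜ] z) atTop := by
  rw [frontier_compl, frontier_closedBall c hR.ne', mem_sphere_iff_norm] at hz
  have hk : 0 < ((finrank ℝ E : ℝ) - 2) / 2 := by
    have : (3 : ℝ) ≤ finrank ℝ E := by exact_mod_cast hn
    linarith
  have hden : Tendsto (fun x : E => ‖x - c‖ ^ 2 - R ^ 2) (𝓝[(closedBall c R)ᶜ] z) (𝓝[>] 0) := by
    refine tendsto_nhdsWithin_iff.2 ⟨?_, ?_⟩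
    · have hcont : Continuous fun x : E => ‖x - c‖ ^ 2 - R ^ 2 := by fun_prop
      have h0 : ‖z - c‖ ^ 2 - R ^ 2 = 0 := by rw [hz]; ring
      simpa [h0] using (hcont.tendsto z).mono_left nhdsWithin_le_nhds
    · exact eventually_mem_nhdsWithin.mono fun x hx => by
        have h := sq_lt_norm_sub_sq_of_mem_compl_closedBall hR hx
        show 0 < ‖x - c‖ ^ 2 - R ^ 2
        linarith
  have hbase : Tendsto (fun x : E => 2 * R / (‖x - c‖ ^ 2 - R ^ 2)) (𝓝[(closedBall c R)ᶜ] z)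
      atTop := by
    simp only [div_eq_mul_inv]
    exact (tendsto_inv_nhdsGT_zero.comp hden).const_mul_atTop (by linarith)
  exact (tendsto_rpow_atTop hk).comp hbase

/-- **The exterior profile is a positive large solution of `ℝⁿ ∖ B̄(c,R)`**, `n ≥ 3` (Han–Shen 2020,
(2.2)). [cite: HanShen2020, (2.2)] -/
theorem isLargeSolution_exteriorProfile (hn : 3 ≤ finrank ℝ E) (c : E) {R : ℝ} (hR : 0 < R) :
    IsLargeSolution (closedBall c R)ᶜ (exteriorProfile c R) where
  toIsSolution := isSolution_exteriorProfile c hR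
  tendsto_atTop := fun _ hz => tendsto_exteriorProfile_atTop hn c hR hz

/-- Under F1, `u_{ℝⁿ ∖ B̄(c,R)} ≥ (2R/(|x-c|² - R²))^{(n-2)/2}` (maximality; equality — the exterior
value of LN4 — additionally needs the removability of an isolated singularity, not vendored here).
[folklore] -/
theorem exteriorProfile_le_loewnerNirenberg (h1 : exists_isMaximalSolution (E := E))
    (hn : 3 ≤ finrank ℝ E) (c : E) {R : ℝ} (hR : 0 < R) (hconn : IsConnected (closedBall c R)ᶜ)
    {x : E} (hx : x ∈ (closedBall c R)ᶜ) :
    exteriorProfile c R x ≤ loewnerNirenberg (closedBall c R)ᶜ x := by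
  have hc : (closure (closedBall c R)ᶜ)ᶜ.Nonempty :=
    ⟨c, by
      rw [closure_compl, mem_compl_iff, Set.notMem_compl_iff]
      exact mem_interior_iff_mem_nhds.2 (closedBall_mem_nhds c hR)⟩
  exact (isMaximalSolution_loewnerNirenberg h1 hn isClosed_closedBall.isOpen_compl hconn hc).le
    (isSolution_exteriorProfile c hR) hx

/-! ### F3. Boundary asymptotics on `C²` domains -/

/-- **F3 (Loewner–Nirenberg boundary asymptotics).** Let `n ≥ 3`, `Ω ⊂ ℝⁿ` a bounded domain with
`C²` boundary, `d(x) = dist(x, ∂Ω)`, and `u ∈ C^∞(Ω)` a positive solution of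
`Δu = ¼n(n-2)u^{(n+2)/(n-2)}` in `Ω`, `u = ∞` on `∂Ω`. Then there are `C` and `δ > 0` with
`|d(x)^{(n-2)/2} u(x) - 1| ≤ C d(x)` whenever `x ∈ Ω`, `d(x) < δ` (Han–Shen 2020, (1.3): "Loewner
and Nirenberg … proved, for `d` sufficiently small, `|d^{(n-2)/2}u - 1| ≤ Cd`" for `C²` boundaries;
proved there as Thm. 3.1 with `α = 1`, locally near each boundary point with `r`, `C` depending only
on `n` and the geometry of `Ω`, whence globally by compactness of `∂Ω`).
[cite: HanShen2020, (1.3) and Thm. 3.1 (LoewnerNirenberg1974)] -/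
def boundary_asymptotics : Prop :=
  ∀ ⦃Ω : Opens E⦄, 3 ≤ finrank ℝ E → IsBounded (Ω : Set E) → IsConnected (Ω : Set E) →
    IsContDiffDomain 2 Ω → ∀ ⦃u : E → ℝ⦄, IsLargeSolution (Ω : Set E) u →
    (∀ x ∈ (Ω : Set E), 0 < u x) → ContDiffOn ℝ ∞ u (Ω : Set E) →
    ∃ C δ : ℝ, 0 < δ ∧ ∀ x ∈ (Ω : Set E), infDist x (frontier (Ω : Set E)) < δ →
      |infDist x (frontier (Ω : Set E)) ^ (((finrank ℝ E : ℝ) - 2) / 2) * u x - 1|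
        ≤ C * infDist x (frontier (Ω : Set E))

/-- **LN1 (asymptotics) — `d(x)^{(n-2)/2} u(x) → 1` at the boundary** (from F3), in `ε`–`δ` form.
[cite: HanShen2020, (1.3)] -/
theorem tendsto_boundary_asymptotics (h3 : boundary_asymptotics (E := E)) (hn : 3 ≤ finrank ℝ E)
    {Ω : Opens E} (hb : IsBounded (Ω : Set E)) (hconn : IsConnected (Ω : Set E))
    (hΩ : IsContDiffDomain 2 Ω) {u : E → ℝ} (hu : IsLargeSolution (Ω : Set E) u)
    (hpos : ∀ x ∈ (Ω : Set E), 0 < u x) (hsmooth : ContDiffOn ℝ ∞ u (Ω : Set E)) {ε : ℝ}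
    (hε : 0 < ε) :
    ∃ δ : ℝ, 0 < δ ∧ ∀ x ∈ (Ω : Set E), infDist x (frontier (Ω : Set E)) < δ →
      |infDist x (frontier (Ω : Set E)) ^ (((finrank ℝ E : ℝ) - 2) / 2) * u x - 1| < ε := by
  obtain ⟨C, δ, hδ, hC⟩ := h3 hn hb hconn hΩ hu hpos hsmooth
  refine ⟨min δ (ε / (|C| + 1)), lt_min hδ (by positivity), fun x hx hd => ?_⟩
  have hd1 : infDist x (frontier (Ω : Set E)) < δ := hd.trans_le (min_le_left _ _)
  have hd2 : infDist x (frontier (Ω : Set E)) < ε / (|C| + 1) := hd.trans_le (min_le_right _ _)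
  have h0 : 0 ≤ infDist x (frontier (Ω : Set E)) := infDist_nonneg
  calc |infDist x (frontier (Ω : Set E)) ^ (((finrank ℝ E : ℝ) - 2) / 2) * u x - 1|
      ≤ C * infDist x (frontier (Ω : Set E)) := hC x hx hd1
    _ ≤ |C| * infDist x (frontier (Ω : Set E)) := mul_le_mul_of_nonneg_right (le_abs_self C) h0
    _ ≤ (|C| + 1) * infDist x (frontier (Ω : Set E)) :=
        mul_le_mul_of_nonneg_right (by linarith [abs_nonneg C]) h0
    _ < (|C| + 1) * (ε / (|C| + 1)) := mul_lt_mul_of_pos_left hd2 (by positivity)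
    _ = ε := by field_simp

/-! ### Similarity covariance (proved, unconditional) -/

section Similarity

variable {F : Type*} [NormedAddCommGroup F] [NormedSpace ℝ F]

/-- The Laplacian commutes with linear isometries: `Δ(g ∘ R)(x) = (Δg)(R x)` (the second
derivatives summed over the orthonormal basis `R b`). [folklore] -/
theorem laplacian_comp_linearIsometryEquiv (R : E ≃ₗᵢ[ℝ] E) (g : E → F) (x : E) :
    (Δ (fun y => g (R y))) x = (Δ g) (R x) := by
  set b := stdOrthonormalBasis ℝ E
  rw [InnerProductSpace.laplacian_eq_iteratedFDeriv_orthonormalBasis _ b,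
    InnerProductSpace.laplacian_eq_iteratedFDeriv_orthonormalBasis _ (b.map R)]
  refine Finset.sum_congr rfl fun i _ => ?_
  have h1 : (fun y => g (R y)) = g ∘ R.toContinuousLinearEquiv := rfl
  rw [h1, ← iteratedFDerivWithin_univ, ← iteratedFDerivWithin_univ]
  have h2 := R.toContinuousLinearEquiv.iteratedFDerivWithin_comp_right g uniqueDiffOn_univ
    (x := x) (mem_univ _) 2
  rw [preimage_univ] at h2
  rw [h2, ContinuousMultilinearMap.compContinuousLinearMap_apply]
  congr 1
  funext j
  fin_cases j <;> simp

omit [InnerProductSpace ℝ E] [FiniteDimensional ℝ E] in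
/-- `D(a • f(b ·)) = z ↦ (a b) • Df(b z)` (no differentiability needed; Mathlib's
`fderiv_comp_smul` for the homothety, `fderiv_const_smul_field` for the constant). [folklore] -/
theorem fderiv_const_smul_comp_smul' [NormedSpace ℝ E] (f : E → F) (a b : ℝ) :
    fderiv ℝ (fun w => a • f (b • w)) = fun z => (a * b) • fderiv ℝ f (b • z) := by
  funext z
  have : (fun w => a • f (b • w)) = a • fun w => f (b • w) := rfl
  rw [this, fderiv_const_smul_field, Pi.smul_apply, _root_.fderiv_comp_smul, smul_smul]

omit [InnerProductSpace ℝ E] [FiniteDimensional ℝ E] in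
/-- `D²(a • f(b ·)) = z ↦ (a b²) • D²f(b z)`. [folklore] -/
theorem fderiv2_const_smul_comp_smul' [NormedSpace ℝ E] (f : E → F) (a b : ℝ) :
    fderiv ℝ (fderiv ℝ (fun w => a • f (b • w))) =
      fun z => (a * b ^ 2) • fderiv ℝ (fderiv ℝ f) (b • z) := by
  rw [fderiv_const_smul_comp_smul' f a b, fderiv_const_smul_comp_smul' (fderiv ℝ f) (a * b) b]
  funext z
  rw [sq, mul_assoc]

/-- `Δ(a • f(b ·))(z) = (a b²) • (Δf)(b z)` (no differentiability needed: both sides are computed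
with Mathlib's total `fderiv`). [folklore] -/
theorem laplacian_const_smul_comp_smul' (f : E → F) (a b : ℝ) (z : E) :
    (Δ (fun w => a • f (b • w))) z = (a * b ^ 2) • (Δ f) (b • z) := by
  rw [InnerProductSpace.laplacian_eq_iteratedFDeriv_stdOrthonormalBasis,
    InnerProductSpace.laplacian_eq_iteratedFDeriv_stdOrthonormalBasis]
  simp only [iteratedFDeriv_two_apply, Finset.smul_sum]
  refine Finset.sum_congr rfl fun i _ => ?_
  rw [fderiv2_const_smul_comp_smul' f a b]
  simp

/-- The Laplacian under homotheties: `Δ(g(μ ·))(x) = μ² (Δg)(μ x)`. [folklore] -/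
theorem laplacian_comp_smul (g : E → F) (μ : ℝ) (x : E) :
    (Δ (fun y => g (μ • y))) x = μ ^ 2 • (Δ g) (μ • x) := by
  have e : (fun y => g (μ • y)) = fun y => (1 : ℝ) • g (μ • y) := by
    funext y; rw [one_smul]
  rw [e, laplacian_const_smul_comp_smul' g 1 μ x, one_mul]

/-- The Laplacian of a constant multiple: `Δ(a • f)(x) = a • (Δf)(x)` (no differentiability
needed). [folklore] -/
theorem laplacian_const_smul' (a : ℝ) (f : E → F) (x : E) :
    (Δ (fun y => a • f y)) x = a • (Δ f) x := by
  have e : (fun y => a • f y) = fun y => a • f ((1 : ℝ) • y) := by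
    funext y; rw [one_smul]
  rw [e, laplacian_const_smul_comp_smul' f a 1 x, one_pow, mul_one, one_smul]

/-- The SIMILARITY `x ↦ c + μ • R x` of `E` (`R` a linear isometry, `μ` a scale, `c` a
translation): together with the inversions these generate the Möbius group; its conformal
factor is the constant `μ`. [folklore] -/
def similarity (R : E ≃ₗᵢ[ℝ] E) (μ : ℝ) (c : E) (x : E) : E := c + μ • R x

omit [FiniteDimensional ℝ E] in
/-- The inverse similarity undoes the similarity. [folklore] -/
theorem similarity_symm_apply (R : E ≃ₗᵢ[ℝ] E) {μ : ℝ} (hμ : μ ≠ 0) (c x : E) :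
    similarity R.symm μ⁻¹ (-(μ⁻¹ • R.symm c)) (similarity R μ c x) = x := by
  simp only [similarity, map_add, LinearIsometryEquiv.map_smul, LinearIsometryEquiv.symm_apply_apply,
    smul_add, smul_smul, inv_mul_cancel₀ hμ, one_smul]
  abel

omit [FiniteDimensional ℝ E] in
/-- The similarity undoes the inverse similarity. [folklore] -/
theorem similarity_apply_symm (R : E ≃ₗᵢ[ℝ] E) {μ : ℝ} (hμ : μ ≠ 0) (c y : E) :
    similarity R μ c (similarity R.symm μ⁻¹ (-(μ⁻¹ • R.symm c)) y) = y := by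
  simp only [similarity, map_add, map_neg, LinearIsometryEquiv.map_smul,
    LinearIsometryEquiv.apply_symm_apply, smul_add, smul_neg, smul_smul, mul_inv_cancel₀ hμ, one_smul]
  abel

omit [FiniteDimensional ℝ E] in
/-- `ψ(φ(Ω)) = Ω` for the inverse similarity `ψ`. [folklore] -/
theorem image_similarity_symm_image (R : E ≃ₗᵢ[ℝ] E) {μ : ℝ} (hμ : μ ≠ 0) (c : E) (Ω : Set E) :
    similarity R.symm μ⁻¹ (-(μ⁻¹ • R.symm c)) '' (similarity R μ c '' Ω) = Ω := by
  rw [Set.image_image]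
  simp only [similarity_symm_apply R hμ, Set.image_id']

omit [FiniteDimensional ℝ E] in
/-- Similarities are smooth. [folklore] -/
theorem contDiff_similarity (R : E ≃ₗᵢ[ℝ] E) (μ : ℝ) (c : E) {m : WithTop ℕ∞} :
    ContDiff ℝ m (similarity R μ c) :=
  contDiff_const.add (R.toContinuousLinearEquiv.contDiff.const_smul μ)

/-- The Laplacian under a similarity: `Δ(v ∘ φ)(x) = μ² (Δv)(φ x)` for `φ x = c + μ R x`.
[folklore] -/
theorem laplacian_comp_similarity (R : E ≃ₗᵢ[ℝ] E) (μ : ℝ) (c : E) (v : E → F) (x : E) :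
    (Δ (fun y => v (similarity R μ c y))) x = μ ^ 2 • (Δ v) (similarity R μ c x) := by
  have e : (fun y => v (similarity R μ c y)) = fun y => v (μ • R y - -c) := by
    funext y
    simp only [similarity]
    congr 1
    abel
  rw [e, laplacian_comp_linearIsometryEquiv R (fun w => v (μ • w - -c)) x,
    laplacian_comp_smul (fun z => v (z - -c)) μ (R x), laplacian_translate_sub v (-c) (μ • R x)]
  simp only [similarity]
  congr 2
  abel

/-- **Transport of solutions under similarities**: if `v` solves the Loewner–Nirenberg equation on
`φ(Ω)`, `φ x = c + μ R x` with `μ > 0`, then `x ↦ μ^{(n-2)/2} v(φ x)` solves it on `Ω` (chain rule: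
`Δ(v ∘ φ) = μ² (Δv) ∘ φ`, and `μ^{(n-2)/2} μ² = (μ^{(n-2)/2})^{(n+2)/(n-2)}`). [folklore] -/
theorem IsSolution.comp_similarity {Ω : Set E} {v : E → ℝ} (R : E ≃ₗᵢ[ℝ] E) {μ : ℝ} (hμ : 0 < μ)
    (c : E) (hv : IsSolution (similarity R μ c '' Ω) v) :
    IsSolution Ω (fun x => μ ^ (((finrank ℝ E : ℝ) - 2) / 2) * v (similarity R μ c x)) := by
  obtain ⟨k, hk⟩ : ∃ k : ℝ, ((finrank ℝ E : ℝ) - 2) / 2 = k := ⟨_, rfl⟩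
  rw [hk]
  have hμk : 0 ≤ μ ^ k := Real.rpow_nonneg hμ.le _
  refine ⟨?_, ?_, ?_⟩
  · have hcomp : ContDiffOn ℝ 2 (v ∘ similarity R μ c) Ω :=
      hv.contDiffOn.comp (contDiff_similarity R μ c).contDiffOn (mapsTo_image _ _)
    exact contDiffOn_const.mul hcomp
  · intro x hx
    exact mul_nonneg hμk (hv.nonneg (mem_image_of_mem _ hx))
  · intro x hx
    have hx' : similarity R μ c x ∈ similarity R μ c '' Ω := mem_image_of_mem _ hx
    have hΔ : (Δ (fun y => μ ^ k * v (similarity R μ c y))) x =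
        μ ^ k * (μ ^ 2 * (Δ v) (similarity R μ c x)) := by
      have h1 := laplacian_const_smul' (μ ^ k) (fun y => v (similarity R μ c y)) x
      have h2 := laplacian_comp_similarity R μ c v x
      simp only [smul_eq_mul] at h1 h2
      rw [h1, h2]
    rw [hΔ, hv.laplacian_eq hx']
    -- the algebra `μ^k μ² f(t) = f(μ^k t)`
    have ht : 0 ≤ v (similarity R μ c x) := hv.nonneg hx'
    simp only [nonlinearity, coeff, exponent]
    rcases eq_or_ne ((finrank ℝ E : ℝ) - 2) 0 with h2 | h2
    · have hk0 : k = 0 := by rw [← hk, h2]; simp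
      rw [hk0, h2]
      simp
    · have hkp : k * ((((finrank ℝ E : ℕ) : ℝ) + 2) / (((finrank ℝ E : ℕ) : ℝ) - 2)) = k + 2 := by
        rw [← hk]
        field_simp
        ring
      rw [Real.mul_rpow hμk ht, ← Real.rpow_mul hμ.le, hkp, Real.rpow_add hμ, Real.rpow_two]
      ring

open Pointwise in
/-- The value sets at corresponding points differ exactly by the factor `μ^{(n-2)/2}`. [folklore] -/
theorem valuesAt_similarity (R : E ≃ₗᵢ[ℝ] E) {μ : ℝ} (hμ : 0 < μ) (c : E) (Ω : Set E) (x : E) :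
    valuesAt Ω x =
      (μ ^ (((finrank ℝ E : ℝ) - 2) / 2)) • valuesAt (similarity R μ c '' Ω) (similarity R μ c x) := by
  obtain ⟨k, hk⟩ : ∃ k : ℝ, ((finrank ℝ E : ℝ) - 2) / 2 = k := ⟨_, rfl⟩
  have hμk : 0 < μ ^ k := Real.rpow_pos_of_pos hμ _
  ext s
  constructor
  · rintro ⟨w, hw, rfl⟩
    -- transport `w` to `φ(Ω)` with the inverse similarity `ψ`, `ψ(φ(Ω)) = Ω`
    have hw' : IsSolution
        (similarity R.symm μ⁻¹ (-(μ⁻¹ • R.symm c)) '' (similarity R μ c '' Ω)) w := by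
      rwa [image_similarity_symm_image R hμ.ne' c Ω]
    have hv := hw'.comp_similarity R.symm (inv_pos.2 hμ) (-(μ⁻¹ • R.symm c))
    rw [hk] at hv ⊢
    refine Set.mem_smul_set.2 ⟨_, hv.mem_valuesAt (similarity R μ c x), ?_⟩
    simp only [smul_eq_mul]
    rw [similarity_symm_apply R hμ.ne', ← mul_assoc, Real.inv_rpow hμ.le,
      mul_inv_cancel₀ hμk.ne', one_mul]
  · intro hs
    obtain ⟨t, ⟨v, hv, rfl⟩, rfl⟩ := Set.mem_smul_set.1 hs
    have hw := hv.comp_similarity R hμ c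
    exact ⟨_, hw, by rw [hk, smul_eq_mul]⟩

/-- **Similarity covariance of the Loewner–Nirenberg function** (PROVED, no facts, all `n`): for
`φ x = c + μ R x` with `μ > 0`, `R` a linear isometry, and `x ∈ Ω`,
`u_{φ(Ω)}(φ x) · μ^{(n-2)/2} = u_Ω(x)` — the case `|φ'| ≡ μ` of the Möbius covariance
`u_{φΩ} ∘ φ · |φ'|^{(n-2)/2} = u_Ω` (the solution sets of `Ω` and `φ(Ω)` correspond exactly, so the
suprema scale; no maximal solution is needed). [folklore] -/
theorem loewnerNirenberg_similarity (R : E ≃ₗᵢ[ℝ] E) {μ : ℝ} (hμ : 0 < μ) (c : E) (Ω : Set E)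
    {x : E} (hx : x ∈ Ω) :
    loewnerNirenberg (similarity R μ c '' Ω) (similarity R μ c x) *
        μ ^ (((finrank ℝ E : ℝ) - 2) / 2) = loewnerNirenberg Ω x := by
  rw [loewnerNirenberg_of_mem hx, loewnerNirenberg_of_mem (mem_image_of_mem _ hx),
    valuesAt_similarity R hμ c Ω x, Real.sSup_smul_of_nonneg (Real.rpow_nonneg hμ.le _),
    smul_eq_mul, mul_comm]

/-- **Translation covariance**: `u_{c + Ω}(c + x) = u_Ω(x)`. [folklore] -/
theorem loewnerNirenberg_translate (c : E) (Ω : Set E) {x : E} (hx : x ∈ Ω) :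
    loewnerNirenberg ((fun y => c + y) '' Ω) (c + x) = loewnerNirenberg Ω x := by
  have h := loewnerNirenberg_similarity (LinearIsometryEquiv.refl ℝ E) one_pos c Ω hx
  have e : similarity (LinearIsometryEquiv.refl ℝ E) 1 c = fun y => c + y := by
    funext y; simp [similarity]
  rw [e, Real.one_rpow, mul_one] at h
  exact h

/-- **Dilation covariance**: `u_{μΩ}(μ x) · μ^{(n-2)/2} = u_Ω(x)` for `μ > 0` (in dimension `3`:
`u_{μΩ}(μx) √μ = u_Ω(x)`). [folklore] -/
theorem loewnerNirenberg_dilate {μ : ℝ} (hμ : 0 < μ) (Ω : Set E) {x : E} (hx : x ∈ Ω) :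
    loewnerNirenberg ((fun y => μ • y) '' Ω) (μ • x) * μ ^ (((finrank ℝ E : ℝ) - 2) / 2) =
      loewnerNirenberg Ω x := by
  have h := loewnerNirenberg_similarity (LinearIsometryEquiv.refl ℝ E) hμ 0 Ω hx
  have e : similarity (LinearIsometryEquiv.refl ℝ E) μ 0 = fun y => μ • y := by
    funext y; simp [similarity]
  rw [e] at h
  exact h

/-- **Isometry covariance**: `u_{R(Ω)}(R x) = u_Ω(x)` for a linear isometry `R`. [folklore] -/
theorem loewnerNirenberg_linearIsometryEquiv (R : E ≃ₗᵢ[ℝ] E) (Ω : Set E) {x : E} (hx : x ∈ Ω) :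
    loewnerNirenberg (R '' Ω) (R x) = loewnerNirenberg Ω x := by
  have h := loewnerNirenberg_similarity R one_pos 0 Ω hx
  have e : similarity R 1 0 = fun y => R y := by
    funext y; simp [similarity]
  rw [e, Real.one_rpow, mul_one] at h
  exact h

end Similarity

/-! ### F4. Conformal (inversion) covariance -/

/-- The KELVIN TRANSFORM adapted to the Loewner–Nirenberg equation: for the inversion
`ι = ι_{a,r} : y ↦ a + (r/|y-a|)² (y-a)` in the sphere `S(a,r)` (Mathlib's
`EuclideanGeometry.inversion a r`), `(K u)(y) = ((r/|y-a|)²)^{(n-2)/2} u(ι y)` — the conformal factor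
`|ι'(y)| = r²/|y-a|²` to the power `(n-2)/2` times `u ∘ ι` (González–Li–Nguyen 2018, §2.2:
`u_{x,λ}(y) = (λ/|y-x|)^{n-2} u(x + λ²(y-x)/|y-x|²)`). [cite: GonzalezLiNguyen2018, §2.2] -/
def kelvinTransform (a : E) (r : ℝ) (u : E → ℝ) : E → ℝ := fun y =>
  ((r / dist y a) ^ 2) ^ (((finrank ℝ E : ℝ) - 2) / 2) * u (EuclideanGeometry.inversion a r y)

/-- **F4 (conformal invariance under inversions).** Let `n ≥ 3`, `Ω ⊆ ℝⁿ` open, `a ∉ Ω`, `r > 0`,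
and `u` a solution of `Δu = ¼n(n-2)u^{(n+2)/(n-2)}` on `Ω`. Then the Kelvin transform
`y ↦ (r/|y-a|)^{n-2} u(ι_{a,r} y)` is a solution on `ι_{a,r}(Ω)` (the invariance of the equation
under conformal = Möbius transformations, Loewner–Nirenberg 1974; González–Li–Nguyen 2018, §2.2:
"By conformal invariance" the Kelvin transform `u_{x,λ}` satisfies the same equation).
[cite: GonzalezLiNguyen2018, §2.2 (LoewnerNirenberg1974)] -/
def isSolution_kelvinTransform : Prop :=
  ∀ ⦃Ω : Set E⦄ ⦃u : E → ℝ⦄ ⦃a : E⦄ ⦃r : ℝ⦄, 3 ≤ finrank ℝ E → 0 < r → IsOpen Ω → a ∉ Ω →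
    IsSolution Ω u → IsSolution (EuclideanGeometry.inversion a r '' Ω) (kelvinTransform a r u)

section Inversion

open EuclideanGeometry

variable {a : E} {r : ℝ}

omit [FiniteDimensional ℝ E] in
/-- The conformal factors of an inversion at `y` and at `ι y` are reciprocal:
`(r/|ι y - a|)² = (|y - a|/r)²`. [folklore] -/
theorem inversion_factor_inversion (hr : 0 < r) {y : E} (hy : y ≠ a) :
    (r / dist (inversion a r y) a) ^ 2 = (dist y a / r) ^ 2 := by
  have hd : dist y a ≠ 0 := (dist_pos.2 hy).ne'
  have hr' : r ≠ 0 := hr.ne'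
  rw [dist_inversion_center]
  congr 1
  field_simp

omit [FiniteDimensional ℝ E] in
/-- The Kelvin transform is an involution on functions, off the pole. [folklore] -/
theorem kelvinTransform_kelvinTransform (hr : 0 < r) (u : E → ℝ) {y : E} (hy : y ≠ a) :
    kelvinTransform a r (kelvinTransform a r u) y = u y := by
  have hd : dist y a ≠ 0 := (dist_pos.2 hy).ne'
  have hr' : r ≠ 0 := hr.ne'
  simp only [kelvinTransform]
  rw [inversion_inversion a hr.ne' y, inversion_factor_inversion hr hy, ← mul_assoc,
    ← Real.mul_rpow (sq_nonneg _) (sq_nonneg _)]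
  have : (r / dist y a) ^ 2 * (dist y a / r) ^ 2 = 1 := by
    field_simp
  rw [this, Real.one_rpow, one_mul]

omit [FiniteDimensional ℝ E] in
/-- The Kelvin transform is order preserving. [folklore] -/
theorem kelvinTransform_mono {u v : E → ℝ} {y : E} (h : u (inversion a r y) ≤ v (inversion a r y)) :
    kelvinTransform a r u y ≤ kelvinTransform a r v y :=
  mul_le_mul_of_nonneg_left h (Real.rpow_nonneg (sq_nonneg _) _)

omit [FiniteDimensional ℝ E] in
/-- The pole is not in the image of a set avoiding it. [folklore] -/
theorem notMem_image_inversion {Ω : Set E} (hr : 0 < r) (ha : a ∉ Ω) :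
    a ∉ inversion a r '' Ω := by
  rintro ⟨y, hy, hya⟩
  rw [inversion_eq_center hr.ne'] at hya
  exact ha (hya ▸ hy)

omit [FiniteDimensional ℝ E] in
/-- `ι(ι(Ω)) = Ω`. [folklore] -/
theorem image_inversion_image_inversion {Ω : Set E} (hr : 0 < r) :
    inversion a r '' (inversion a r '' Ω) = Ω := by
  rw [Set.image_image]
  simp only [inversion_inversion a hr.ne', Set.image_id']

omit [FiniteDimensional ℝ E] in
/-- An inversion with nonzero radius maps open sets avoiding the pole to open sets (it is a
homeomorphism of the punctured space onto itself). [folklore] -/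
theorem isOpen_image_inversion {Ω : Set E} (hr : 0 < r) (hΩ : IsOpen Ω) (ha : a ∉ Ω) :
    IsOpen (inversion a r '' Ω) := by
  have hinv := inversion_involutive a hr.ne'
  rw [Set.image_eq_preimage_of_inverse hinv.leftInverse hinv.rightInverse]
  -- `ι ⁻¹' Ω` is open: `ι` is continuous off the pole and `Ω` avoids the pole
  rw [isOpen_iff_mem_nhds]
  intro y hy
  have hya : y ≠ a := by
    rintro rfl
    rw [mem_preimage, inversion_self] at hy
    exact ha hy
  have hcont : ContinuousAt (fun x : E => inversion a r x) y :=
    (continuousAt_const.inversion continuousAt_const continuousAt_id hya)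
  exact hcont.preimage_mem_nhds (hΩ.mem_nhds hy)

omit [FiniteDimensional ℝ E] in
/-- An inversion is continuous on every set avoiding its pole. [folklore] -/
theorem continuousOn_inversion {Ω : Set E} (ha : a ∉ Ω) : ContinuousOn (inversion a r) Ω :=
  fun y hy => (continuousAt_const.inversion continuousAt_const continuousAt_id
    (show id y ≠ a from fun h => ha (h ▸ hy))).continuousWithinAt

/-- **LN2 — Möbius (inversion) covariance of `u_Ω`** (under F1 and F4): for `n ≥ 3`, a domain
`Ω` with `ℝⁿ ∖ Ω̄ ≠ ∅` and `ℝⁿ ∖ cl ι(Ω) ≠ ∅`, pole `a ∉ Ω`, radius `r > 0`, and `x ∈ Ω`: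
`u_{ι(Ω)}(ι x) · ((r/|x-a|)²)^{(n-2)/2} = u_Ω(x)`, i.e. `u_{φΩ} ∘ φ · |φ'|^{(n-2)/2} = u_Ω` for the
Möbius map `φ = ι_{a,r}` (the maximal solution is transported by the order-preserving, involutive
Kelvin correspondence between solutions on `Ω` and on `ι(Ω)`; Loewner–Nirenberg 1974).
[cite: GonzalezLiNguyen2018, §2.2 and Def. 4.1 (LoewnerNirenberg1974)] -/
theorem loewnerNirenberg_inversion (h1 : exists_isMaximalSolution (E := E))
    (h4 : isSolution_kelvinTransform (E := E)) (hn : 3 ≤ finrank ℝ E) {Ω : Set E}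
    (hΩ : IsOpen Ω) (hconn : IsConnected Ω) (hc : (closure Ω)ᶜ.Nonempty)
    (hc' : (closure (inversion a r '' Ω))ᶜ.Nonempty) (ha : a ∉ Ω) (hr : 0 < r) {x : E}
    (hx : x ∈ Ω) :
    loewnerNirenberg (inversion a r '' Ω) (inversion a r x) *
        ((r / dist x a) ^ 2) ^ (((finrank ℝ E : ℝ) - 2) / 2) = loewnerNirenberg Ω x := by
  set Ω' : Set E := inversion a r '' Ω with hΩ'
  have hΩ'o : IsOpen Ω' := isOpen_image_inversion hr hΩ ha
  have hconn' : IsConnected Ω' := hconn.image _ (continuousOn_inversion ha)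
  have ha' : a ∉ Ω' := notMem_image_inversion hr ha
  have hback : inversion a r '' Ω' = Ω := image_inversion_image_inversion hr
  -- one inequality for each of the two domains: `u_{Ω₂} ≤ K u_{Ω₁}` on `Ω₂`, where `ι Ω₂ = Ω₁`
  have key : ∀ {Ω₁ Ω₂ : Set E}, IsOpen Ω₁ → IsConnected Ω₁ → (closure Ω₁)ᶜ.Nonempty → a ∉ Ω₂ →
      IsOpen Ω₂ → inversion a r '' Ω₂ = Ω₁ → ∀ y ∈ Ω₂,
        loewnerNirenberg Ω₂ y ≤ kelvinTransform a r (loewnerNirenberg Ω₁) y := by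
    intro Ω₁ Ω₂ h₁ hconn₁ hc₁ ha₂ h₂ himg y hy
    refine loewnerNirenberg_le fun v hv => ?_
    have hya : y ≠ a := fun h => ha₂ (h ▸ hy)
    -- `K v` solves on `Ω₁`, hence lies below `u_{Ω₁}` there; apply `K` once more
    have hKv : IsSolution Ω₁ (kelvinTransform a r v) := himg ▸ h4 hn hr h₂ ha₂ hv
    have hmem : inversion a r y ∈ Ω₁ := himg ▸ mem_image_of_mem _ hy
    have hle : kelvinTransform a r v (inversion a r y) ≤ loewnerNirenberg Ω₁ (inversion a r y) :=
      hKv.le_loewnerNirenberg' h1 hn h₁ hconn₁ hc₁ hmem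
    calc v y = kelvinTransform a r (kelvinTransform a r v) y :=
          (kelvinTransform_kelvinTransform hr v hya).symm
      _ ≤ kelvinTransform a r (loewnerNirenberg Ω₁) y := kelvinTransform_mono hle
  have hxa : x ≠ a := fun h => ha (h ▸ hx)
  have hx' : inversion a r x ∈ Ω' := mem_image_of_mem _ hx
  -- `u_Ω ≤ K u_Ω'` on `Ω` and `u_Ω' ≤ K u_Ω` on `Ω'`
  have hA : loewnerNirenberg Ω x ≤ kelvinTransform a r (loewnerNirenberg Ω') x :=
    key hΩ'o hconn' hc' ha hΩ hΩ'.symm x hx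
  have hB : loewnerNirenberg Ω' (inversion a r x) ≤
      kelvinTransform a r (loewnerNirenberg Ω) (inversion a r x) :=
    key hΩ hconn hc ha' hΩ'o hback _ hx'
  -- unfold the Kelvin transform and conclude
  set F : ℝ := ((r / dist x a) ^ 2) ^ (((finrank ℝ E : ℝ) - 2) / 2) with hF
  have hfac : 0 ≤ F := Real.rpow_nonneg (sq_nonneg _) _
  have hA' : loewnerNirenberg Ω x ≤ loewnerNirenberg Ω' (inversion a r x) * F := by
    rw [mul_comm]; exact hA
  have hB'' : loewnerNirenberg Ω' (inversion a r x) ≤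
      ((dist x a / r) ^ 2) ^ (((finrank ℝ E : ℝ) - 2) / 2) * loewnerNirenberg Ω x := by
    have h := hB
    simp only [kelvinTransform, inversion_inversion a hr.ne' x, inversion_factor_inversion hr hxa] at h
    exact h
  have hone : ((dist x a / r) ^ 2) ^ (((finrank ℝ E : ℝ) - 2) / 2) * F = 1 := by
    rw [hF, ← Real.mul_rpow (sq_nonneg _) (sq_nonneg _)]
    have hd : dist x a ≠ 0 := (dist_pos.2 hxa).ne'
    have hr' : r ≠ 0 := hr.ne'
    have : (dist x a / r) ^ 2 * (r / dist x a) ^ 2 = 1 := by field_simp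
    rw [this, Real.one_rpow]
  have hB' : loewnerNirenberg Ω' (inversion a r x) * F ≤ loewnerNirenberg Ω x :=
    calc loewnerNirenberg Ω' (inversion a r x) * F
        ≤ ((dist x a / r) ^ 2) ^ (((finrank ℝ E : ℝ) - 2) / 2) * loewnerNirenberg Ω x * F :=
          mul_le_mul_of_nonneg_right hB'' hfac
      _ = loewnerNirenberg Ω x * (((dist x a / r) ^ 2) ^ (((finrank ℝ E : ℝ) - 2) / 2) * F) := by
          ring
      _ = loewnerNirenberg Ω x := by rw [hone, mul_one]
  exact le_antisymm hB' hA'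

end Inversion

/-! ### F5. The half-space -/

/-- The open half-space `H(p,ν) = {x | 0 < ⟪x - p, ν⟫}` through `p` with inner unit normal `ν`.
[folklore] -/
def halfSpace (p ν : E) : Set E := {x | 0 < inner ℝ (x - p) ν}

/-- The HALF-SPACE PROFILE `⟪x - p, ν⟫^{-(n-2)/2} = dist(x, ∂H)^{-(n-2)/2}` (for `‖ν‖ = 1`; the
hyperbolic metric of the half-space; Duncan–Nguyen 2025, Cor. 1.4: `u(x) = x_n^{-(n-2)/2}`).
[cite: DuncanNguyen2025, Cor. 1.4] -/
def halfSpaceProfile (p ν : E) (x : E) : ℝ :=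
  (inner ℝ (x - p) ν) ^ (-(((finrank ℝ E : ℝ) - 2) / 2))

/-- **F5 (the half-space; Duncan–Nguyen 2025, Cor. 1.4, after Han–Shen 2020).** For `n ≥ 3`,
`u(x) = x_n^{-(n-2)/2}` is the unique positive continuous viscosity solution of
`Δu = ¼n(n-2)u^{(n+2)/(n-2)}` in `ℝⁿ₊` with `u(x) → +∞` as `dist(x,K) → 0` for every compact
`K ⊂ ∂ℝⁿ₊`. Vendored for the half-space `H(p,ν)`, `‖ν‖ = 1`, and classical solutions (which are
continuous viscosity solutions; blow-up at every boundary point is the printed boundary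
condition): `⟪x-p,ν⟫^{-(n-2)/2}` is a positive large solution on `H`, and every positive large
solution equals it on `H`. [cite: DuncanNguyen2025, Cor. 1.4] -/
def halfSpace_unique : Prop :=
  ∀ ⦃p ν : E⦄, 3 ≤ finrank ℝ E → ‖ν‖ = 1 →
    (IsLargeSolution (halfSpace p ν) (halfSpaceProfile p ν) ∧
        ∀ x ∈ halfSpace p ν, 0 < halfSpaceProfile p ν x) ∧
      ∀ u : E → ℝ, IsLargeSolution (halfSpace p ν) u → (∀ x ∈ halfSpace p ν, 0 < u x) →
        EqOn u (halfSpaceProfile p ν) (halfSpace p ν)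

omit [FiniteDimensional ℝ E] in
/-- The half-space is open. [folklore] -/
theorem isOpen_halfSpace (p ν : E) : IsOpen (halfSpace p ν) :=
  isOpen_lt continuous_const (by fun_prop)

omit [FiniteDimensional ℝ E] in
/-- Half-spaces are convex. [folklore] -/
theorem convex_halfSpace (p ν : E) : Convex ℝ (halfSpace p ν) := by
  have hlin : IsLinearMap ℝ fun x : E => inner ℝ x ν :=
    ⟨fun x y => inner_add_left x y ν, fun c x => by rw [real_inner_smul_left, smul_eq_mul]⟩
  have : halfSpace p ν = {x | inner ℝ p ν < inner ℝ x ν} := by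
    ext x
    simp only [halfSpace, mem_setOf_eq, inner_sub_left, sub_pos]
  rw [this]
  exact convex_halfSpace_gt hlin _

omit [FiniteDimensional ℝ E] in
/-- `p - ν` is not in the closure of `H(p,ν)` when `ν ≠ 0`. [folklore] -/
theorem compl_closure_halfSpace_nonempty (p : E) {ν : E} (hν : ν ≠ 0) :
    (closure (halfSpace p ν))ᶜ.Nonempty := by
  refine ⟨p - ν, fun h => ?_⟩
  have hsub : closure (halfSpace p ν) ⊆ {x | 0 ≤ inner ℝ (x - p) ν} :=
    closure_minimal (fun x (hx : 0 < inner ℝ (x - p) ν) => hx.le)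
      (isClosed_le continuous_const (by fun_prop))
  have h' := hsub h
  simp only [mem_setOf_eq, sub_sub_cancel_left, inner_neg_left] at h'
  have : 0 < inner ℝ ν ν := real_inner_self_pos.2 hν
  linarith

/-- **LN4 (half-space) — `u_H(x) = dist(x,∂H)^{-(n-2)/2}`** (under F1 and F5): for `n ≥ 3` and
`‖ν‖ = 1`, `u_{H(p,ν)}(x) = ⟪x-p,ν⟫^{-(n-2)/2}` on `H(p,ν)`; in dimension three,
`dist(x,∂H)^{-1/2}`. [cite: DuncanNguyen2025, Cor. 1.4] -/
theorem loewnerNirenberg_halfSpace (h1 : exists_isMaximalSolution (E := E))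
    (h5 : halfSpace_unique (E := E)) (hn : 3 ≤ finrank ℝ E) (p : E) {ν : E} (hν : ‖ν‖ = 1) :
    EqOn (loewnerNirenberg (halfSpace p ν)) (halfSpaceProfile p ν) (halfSpace p ν) := by
  have hν0 : ν ≠ 0 := by
    rintro rfl
    simp at hν
  obtain ⟨⟨hlarge, hpos⟩, huniq⟩ := h5 hn hν
  have hne : (halfSpace p ν).Nonempty :=
    ⟨p + ν, by simp [halfSpace, hν]⟩
  have hconv : Convex ℝ (halfSpace p ν) := convex_halfSpace p ν
  have hmax := isMaximalSolution_loewnerNirenberg h1 hn (isOpen_halfSpace p ν)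
    ⟨hne, hconv.isPreconnected⟩ (compl_closure_halfSpace_nonempty p hν0)
  have hle : ∀ x ∈ halfSpace p ν, halfSpaceProfile p ν x ≤ loewnerNirenberg (halfSpace p ν) x :=
    fun x hx => hmax.le hlarge.toIsSolution hx
  exact huniq _ (hlarge.of_le hmax.toIsSolution hle) fun x hx => (hpos x hx).trans_le (hle x hx)

/-! ### F6. The punctured space and the whole space -/

/-- **F6 (Liouville on the punctured space).** For `n ≥ 3` and `Ω = ℝⁿ ∖ {a}`, the maximal solution
`u_Ω` of the Loewner–Nirenberg equation vanishes identically; since `u_Ω` dominates every solution,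
every (nonnegative classical) solution on `ℝⁿ ∖ {a}` is `≡ 0` there (González–Li–Nguyen 2018, §1,
p. 4: "when `Ω = ℝⁿ ∖ {0}` and `Γ ⊂ Γ₁`, then `u_Ω ≡ 0`", with the footnote proof: `u_Ω` is
bounded, tends to `0` at infinity and is subharmonic across the point; a point is a boundary
portion of Hausdorff dimension `0 < (n-2)/2`, Loewner–Nirenberg 1974).
[cite: GonzalezLiNguyen2018, §1 p. 4 (LoewnerNirenberg1974)] -/
def punctured_space_liouville : Prop :=
  ∀ ⦃a : E⦄ ⦃u : E → ℝ⦄, 3 ≤ finrank ℝ E → IsSolution ({a}ᶜ : Set E) u → EqOn u 0 {a}ᶜ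

/-- **LN4 (punctured space)**: `u_{ℝⁿ ∖ {a}} ≡ 0` (under F6). [cite: GonzalezLiNguyen2018, §1 p. 4] -/
theorem loewnerNirenberg_compl_singleton (h6 : punctured_space_liouville (E := E))
    (hn : 3 ≤ finrank ℝ E) (a x : E) : loewnerNirenberg ({a}ᶜ : Set E) x = 0 := by
  by_cases hx : x ∈ ({a}ᶜ : Set E)
  · exact le_antisymm (loewnerNirenberg_le fun v hv => (h6 hn hv hx).le) (loewnerNirenberg_nonneg _ _)
  · exact loewnerNirenberg_of_notMem hx

/-- **LN4 (whole space)**: `u_{ℝⁿ} ≡ 0` for `n ≥ 3` (under F6: a solution on `ℝⁿ` restricts to a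
solution on `ℝⁿ ∖ {a}`, hence vanishes off `a`, and at `a` by continuity).
[cite: GonzalezLiNguyen2018, §1 p. 4] -/
theorem loewnerNirenberg_univ (h6 : punctured_space_liouville (E := E)) (hn : 3 ≤ finrank ℝ E)
    (x : E) : loewnerNirenberg (univ : Set E) x = 0 := by
  refine le_antisymm (loewnerNirenberg_le fun v hv => ?_) (loewnerNirenberg_nonneg _ _)
  -- pick a point `a ≠ x` and use the Liouville fact on `ℝⁿ ∖ {a}`
  haveI := nontrivial_of_three_le_finrank hn
  obtain ⟨a, ha⟩ := exists_ne x
  have hv' : IsSolution ({a}ᶜ : Set E) v := hv.mono (subset_univ _)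
  exact (h6 hn hv' (mem_compl_singleton_iff.2 ha.symm)).le

/-! ### F6 proved: the classical maximum principle, comparison with balls, Liouville -/

section LiouvilleProof

/-- **Second-order condition at a local maximum** (pointwise `C²` form of
`Literature.Analysis.FluidPDE.laplacian_nonpos_of_isLocalMax`, which asks `ContDiff ℝ 2`
globally): if `w` is `C²` at a local maximum `x`, then `Δw(x) ≤ 0` (each `D²w(x)(bᵢ,bᵢ) ≤ 0` along
an orthonormal basis; the local-minimum form `fderiv_fderiv_nonneg_of_isLocalMin` of
`HopfLemmas.lean` applied to `-w`). [folklore] -/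
theorem laplacian_nonpos_of_isLocalMax {w : E → ℝ} {x : E} (hmax : IsLocalMax w x)
    (hw : ContDiffAt ℝ 2 w x) : (Δ w) x ≤ 0 := by
  have hmin : IsLocalMin (-w) x := hmax.neg
  have hw' : ContDiffAt ℝ 2 (-w) x := hw.neg
  have hsum : 0 ≤ (Δ (-w)) x := by
    rw [congrFun (InnerProductSpace.laplacian_eq_iteratedFDeriv_orthonormalBasis (-w)
      (stdOrthonormalBasis ℝ E)) x]
    refine Finset.sum_nonneg fun i _ => ?_
    rw [iteratedFDeriv_two_apply]
    exact fderiv_fderiv_nonneg_of_isLocalMin hmin hw' _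
  rw [InnerProductSpace.laplacian_neg] at hsum
  simpa using hsum

/-- The exponent `(n+2)/(n-2)` is positive for `n ≥ 3`. [folklore] -/
theorem exponent_pos {n : ℕ} (hn : 3 ≤ n) : 0 < exponent n := by
  unfold exponent
  have : (3 : ℝ) ≤ n := by exact_mod_cast hn
  exact div_pos (by linarith) (by linarith)

/-- The coefficient `¼ n(n-2)` is positive for `n ≥ 3`. [folklore] -/
theorem coeff_pos {n : ℕ} (hn : 3 ≤ n) : 0 < coeff n := by
  unfold coeff
  have h3 : (3 : ℝ) ≤ n := by exact_mod_cast hn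
  have : 0 < (n : ℝ) * ((n : ℝ) - 2) := mul_pos (by linarith) (by linarith)
  linarith

/-- The nonlinearity `f_n(t) = ¼n(n-2)t^{(n+2)/(n-2)}` is strictly increasing on `[0, ∞)` for
`n ≥ 3`. [folklore] -/
theorem nonlinearity_lt_nonlinearity {n : ℕ} (hn : 3 ≤ n) {s t : ℝ} (hs : 0 ≤ s) (hst : s < t) :
    nonlinearity n s < nonlinearity n t :=
  mul_lt_mul_of_pos_left (Real.rpow_lt_rpow hs hst (exponent_pos hn)) (coeff_pos hn)

/-- `f_n(t) > 0` for `t > 0`, `n ≥ 3`. [folklore] -/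
theorem nonlinearity_pos {n : ℕ} (hn : 3 ≤ n) {t : ℝ} (ht : 0 < t) : 0 < nonlinearity n t := by
  simpa using nonlinearity_lt_nonlinearity hn le_rfl ht

omit [InnerProductSpace ℝ E] [FiniteDimensional ℝ E] in
/-- `s ≤ R² - ‖y - c‖²` with `s > 0` forces `y` into the open ball `B(c,R)` (`R > 0`).
[folklore] -/
theorem mem_ball_of_le_sq_sub_norm_sq [NormedSpace ℝ E] {c y : E} {R s : ℝ} (hR : 0 < R)
    (hs : 0 < s) (h : s ≤ R ^ 2 - ‖y - c‖ ^ 2) : y ∈ ball c R := by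
  rw [mem_ball, dist_eq_norm]
  have h2 : ‖y - c‖ ^ 2 < R ^ 2 := by linarith
  exact lt_of_pow_lt_pow_left₀ 2 hR.le h2

/-- **Comparison with the ball solution** (the classical comparison principle behind
González–Li–Nguyen 2018, Lemma 3.1: "`v ≤ u^{(in)}_{R,x}` in `B_R(x)`"): if `u` is a (nonnegative
classical) solution on an open set `Ω ⊇ B̄(c,R)`, `R > 0`, `n ≥ 3`, then `u ≤ u_{R,c}` on `B(c,R)`,
`u_{R,c} = (2R/(R² - |x-c|²))^{(n-2)/2}` the Poincaré-ball solution.  Proof: `u ≤ M` on the compact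
closed ball while `u_{R,c} > M` on a shell `R² - |y-c|² ≤ s`; a positive maximum of `u - u_{R,c}`
over `{R² - |y-c|² ≥ s}` would be an interior local maximum with
`Δ(u - u_{R,c}) = f_n(u) - f_n(u_{R,c}) > 0`, against `laplacian_nonpos_of_isLocalMax`.
[cite: GonzalezLiNguyen2018, Lemma 3.1 (proof)] -/
theorem IsSolution.le_ballProfile (hn : 3 ≤ finrank ℝ E) {Ω : Set E} {u : E → ℝ}
    (hu : IsSolution Ω u) (hΩ : IsOpen Ω) {c : E} {R : ℝ} (hR : 0 < R)
    (hsub : closedBall c R ⊆ Ω) {x : E} (hx : x ∈ ball c R) : u x ≤ ballProfile c R x := by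
  obtain ⟨k, hk⟩ : ∃ k : ℝ, ((finrank ℝ E : ℝ) - 2) / 2 = k := ⟨_, rfl⟩
  have hk0 : 0 < k := by
    have : (3 : ℝ) ≤ finrank ℝ E := by exact_mod_cast hn
    rw [← hk]; linarith
  -- `u ≤ M` on the compact closed ball
  have hcont : ContinuousOn u (closedBall c R) := hu.contDiffOn.continuousOn.mono hsub
  obtain ⟨M, hM⟩ : ∃ M : ℝ, ∀ y ∈ closedBall c R, u y ≤ M := by
    obtain ⟨M, hM⟩ := (isCompact_closedBall c R).bddAbove_image hcont
    exact ⟨M, fun y hy => hM (mem_image_of_mem u hy)⟩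
  -- a level `s > 0` of `R² - ‖y - c‖²`, below the level of `x`, on which the profile exceeds `M`
  have hρ : 0 < R ^ 2 - ‖x - c‖ ^ 2 := by
    have := norm_sub_sq_lt_of_mem_ball hx
    linarith
  have hlim : Tendsto (fun s : ℝ => (2 * R / s) ^ k) (𝓝[>] 0) atTop := by
    simp only [div_eq_mul_inv]
    exact (tendsto_rpow_atTop hk0).comp (tendsto_inv_nhdsGT_zero.const_mul_atTop (by linarith))
  obtain ⟨s, ⟨hsM, hsx⟩, hs0⟩ :=
    (((hlim.eventually (eventually_gt_atTop M)).and
      (mem_nhdsWithin_of_mem_nhds (Iio_mem_nhds hρ))).and self_mem_nhdsWithin).exists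
  have hs0 : 0 < s := hs0
  have hsx : s < R ^ 2 - ‖x - c‖ ^ 2 := hsx
  -- the compact superlevel set `K = {R² - ‖y-c‖² ≥ s}` and its open interior part `V`
  set K : Set E := {y | s ≤ R ^ 2 - ‖y - c‖ ^ 2} with hK
  set V : Set E := {y | s < R ^ 2 - ‖y - c‖ ^ 2} with hV
  have hcts : Continuous fun y : E => R ^ 2 - ‖y - c‖ ^ 2 := by fun_prop
  have hKball : K ⊆ ball c R := fun y hy => mem_ball_of_le_sq_sub_norm_sq hR hs0 hy
  have hKc : IsCompact K :=
    (isCompact_closedBall c R).of_isClosed_subset (isClosed_le continuous_const hcts)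
      (hKball.trans ball_subset_closedBall)
  have hVo : IsOpen V := isOpen_lt continuous_const hcts
  have hVK : V ⊆ K := fun y hy => le_of_lt (show s < R ^ 2 - ‖y - c‖ ^ 2 from hy)
  have hxK : x ∈ K := hsx.le
  -- `w = u - u_{R,c}` attains its maximum over `K` at some `x₀`
  set w : E → ℝ := u - ballProfile c R with hw
  have hwc : ContinuousOn w K :=
    (hu.contDiffOn.continuousOn.mono (hKball.trans (ball_subset_closedBall.trans hsub))).sub
      ((contDiffOn_ballProfile c hR).continuousOn.mono hKball)
  obtain ⟨x₀, hx₀K, hmax⟩ := hKc.exists_isMaxOn ⟨x, hxK⟩ hwc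
  -- either the maximum is `≤ 0` (done) or positive (contradiction)
  by_contra hlt
  have hwx : 0 < w x := by
    simp only [hw, Pi.sub_apply]
    linarith [not_le.1 hlt]
  have hw0 : 0 < w x₀ := hwx.trans_le (hmax hxK)
  have hx₀ball : x₀ ∈ ball c R := hKball hx₀K
  have hUpos : 0 < ballProfile c R x₀ := ballProfile_pos hR hx₀ball
  have hux₀ : ballProfile c R x₀ < u x₀ := by
    have : 0 < u x₀ - ballProfile c R x₀ := hw0
    linarith
  -- `x₀` is not on the level `s`: there the profile exceeds `M ≥ u`
  have hx₀V : x₀ ∈ V := by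
    rcases (show s ≤ R ^ 2 - ‖x₀ - c‖ ^ 2 from hx₀K).lt_or_eq with h | h
    · exact h
    · exfalso
      have hprof : ballProfile c R x₀ = (2 * R / s) ^ k := by
        rw [ballProfile, hk, ← h]
      have h1 : u x₀ ≤ M := hM x₀ (ball_subset_closedBall hx₀ball)
      linarith
  -- so `x₀` is an interior local maximum of the `C²` function `w`
  have hlocal : IsLocalMax w x₀ := hmax.isLocalMax (mem_of_superset (hVo.mem_nhds hx₀V) hVK)
  have hu2 : ContDiffAt ℝ 2 u x₀ :=
    hu.contDiffOn.contDiffAt (hΩ.mem_nhds (hsub (ball_subset_closedBall hx₀ball)))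
  have hU2 : ContDiffAt ℝ 2 (ballProfile c R) x₀ :=
    (contDiffOn_ballProfile c hR).contDiffAt (isOpen_ball.mem_nhds hx₀ball)
  have hΔle : (Δ w) x₀ ≤ 0 := laplacian_nonpos_of_isLocalMax hlocal (hu2.sub hU2)
  have hΔ : (Δ w) x₀ = nonlinearity (finrank ℝ E) (u x₀) -
      nonlinearity (finrank ℝ E) (ballProfile c R x₀) := by
    rw [hw, hu2.laplacian_sub hU2, hu.laplacian_eq (hsub (ball_subset_closedBall hx₀ball)),
      (isSolution_ballProfile c hR).laplacian_eq hx₀ball]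
  have hgap : nonlinearity (finrank ℝ E) (ballProfile c R x₀) <
      nonlinearity (finrank ℝ E) (u x₀) := nonlinearity_lt_nonlinearity hn hUpos.le hux₀
  linarith

/-- **A-priori bound on the punctured space** (González–Li–Nguyen 2018, Lemma 3.1 with
`Ω = ℝⁿ ∖ {a}`, `R = |x-a|/2`): a solution `u` on `ℝⁿ ∖ {a}` satisfies
`u(x) ≤ 4^{(n-2)/2} |x-a|^{-(n-2)/2}` for `x ≠ a`. [cite: GonzalezLiNguyen2018, Lemma 3.1] -/
theorem IsSolution.le_of_compl_singleton (hn : 3 ≤ finrank ℝ E) {a : E} {u : E → ℝ}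
    (hu : IsSolution ({a}ᶜ : Set E) u) {x : E} (hx : x ≠ a) :
    u x ≤ (4 : ℝ) ^ (((finrank ℝ E : ℝ) - 2) / 2) * ‖x - a‖ ^ (-(((finrank ℝ E : ℝ) - 2) / 2)) := by
  have hd : 0 < ‖x - a‖ := norm_pos_iff.2 (sub_ne_zero.2 hx)
  set R : ℝ := ‖x - a‖ / 2 with hRdef
  have hR : 0 < R := by positivity
  have hsub : closedBall x R ⊆ ({a}ᶜ : Set E) := by
    intro y hy
    rw [mem_compl_singleton_iff]
    rintro rfl
    rw [mem_closedBall, dist_comm, dist_eq_norm] at hy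
    linarith
  have h := hu.le_ballProfile hn isOpen_compl_singleton hR hsub (mem_ball_self hR)
  have hval : ballProfile x R x =
      (4 : ℝ) ^ (((finrank ℝ E : ℝ) - 2) / 2) * ‖x - a‖ ^ (-(((finrank ℝ E : ℝ) - 2) / 2)) := by
    rw [ballProfile, sub_self, norm_zero, Real.rpow_neg hd.le, ← Real.inv_rpow hd.le,
      ← Real.mul_rpow (by norm_num) (inv_nonneg.2 hd.le)]
    congr 1
    rw [hRdef]
    field_simp
    ring
  exact h.trans_eq hval

/-- **The fundamental solution is harmonic off its pole**: for `n = dim E` and `x ≠ a`,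
`Δ (|y-a|²)^{-(n-2)/2} = 0` at `x` (radial computation `Δg(|y|²) = 4|y|²g'' + 2n g'` with
`g(σ) = σ^{-(n-2)/2}`). [folklore] -/
theorem laplacian_fundamental_eq_zero {a x : E} (hx : x ≠ a) :
    (Δ (fun y : E => (‖y - a‖ ^ 2) ^ (-(((finrank ℝ E : ℝ) - 2) / 2)))) x = 0 := by
  obtain ⟨p, hp⟩ : ∃ p : ℝ, -(((finrank ℝ E : ℝ) - 2) / 2) = p := ⟨_, rfl⟩
  rw [hp]
  have hd : 0 < ‖x - a‖ := norm_pos_iff.2 (sub_ne_zero.2 hx)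
  have hs : 0 < ‖x - a‖ ^ 2 := by positivity
  have hg : ∀ σ ∈ Ioi (0 : ℝ), HasDerivAt (fun τ : ℝ => τ ^ p) (p * σ ^ (p - 1)) σ := fun σ hσ =>
    Real.hasDerivAt_rpow_const (Or.inl (ne_of_gt hσ))
  have hg₁ : HasDerivAt (fun σ : ℝ => p * σ ^ (p - 1)) (p * ((p - 1) * (‖x - a‖ ^ 2) ^ (p - 1 - 1)))
      (‖x - a‖ ^ 2) := (Real.hasDerivAt_rpow_const (Or.inl hs.ne')).const_mul p
  have h1 := laplacian_translate_sub (fun w : E => (‖w‖ ^ 2) ^ p) a x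
  have h2 := Literature.Analysis.FluidPDE.laplacian_comp_norm_sq (E := E) isOpen_Ioi hg
    (show ‖x - a‖ ^ 2 ∈ Ioi (0 : ℝ) from hs) hg₁
  rw [h1, h2, Real.rpow_sub_one hs.ne' (p - 1)]
  have hpn : 4 * p - 4 + 2 * (finrank ℝ E : ℝ) = 0 := by rw [← hp]; ring
  have hq : ∀ q : ℝ, 4 * (p * ((p - 1) * (q / ‖x - a‖ ^ 2))) * ‖x - a‖ ^ 2 +
      2 * (finrank ℝ E : ℝ) * (p * q) = p * q * (4 * p - 4 + 2 * (finrank ℝ E : ℝ)) := by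
    intro q
    field_simp
  rw [hq, hpn, mul_zero]

omit [InnerProductSpace ℝ E] [FiniteDimensional ℝ E] in
/-- The closed annulus `ρ ≤ |y-a| ≤ R'` is compact (finite dimension). [folklore] -/
theorem isCompact_annulus [NormedSpace ℝ E] [ProperSpace E] (a : E) (ρ R' : ℝ) :
    IsCompact {y : E | ρ ≤ ‖y - a‖ ∧ ‖y - a‖ ≤ R'} := by
  have h : {y : E | ρ ≤ ‖y - a‖ ∧ ‖y - a‖ ≤ R'} = {y : E | ρ ≤ ‖y - a‖} ∩ closedBall a R' := by
    ext y
    simp [mem_closedBall, dist_eq_norm]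
  rw [h]
  exact (isCompact_closedBall a R').inter_left
    (isClosed_le continuous_const (continuous_norm.comp (continuous_id.sub continuous_const)))

/-- **F6 PROVED — Liouville on the punctured space** (González–Li–Nguyen 2018, §1 p. 4 with its
footnote; Loewner–Nirenberg 1974): for `n ≥ 3` every nonnegative classical solution of
`Δu = ¼n(n-2)u^{(n+2)/(n-2)}` on `ℝⁿ ∖ {a}` vanishes identically.  Proof (the footnote, made
quantitative): by the a-priori bound `u ≤ 4^{(n-2)/2}|x-a|^{-(n-2)/2}` (Lemma 3.1) `u → 0` at
infinity and `u = o(|x-a|^{2-n})` at `a`, so for `ε, δ > 0` the function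
`w = u - ε|x-a|^{2-n} - δ` is negative on the spheres `|x-a| = ρ` (small) and `|x-a| = R'`
(large); a positive maximum of `w` over the annulus would be an interior local maximum with
`Δw = f_n(u) > 0` (`|x-a|^{2-n}` is harmonic), impossible; hence `u ≤ ε|x-a|^{2-n} + δ`, and
`ε, δ → 0`. [cite: GonzalezLiNguyen2018, §1 p. 4 (footnote) and Lemma 3.1] -/
theorem punctured_space_liouville_holds : punctured_space_liouville (E := E) := by
  intro a u hn hu x hx
  have hxa : x ≠ a := hx
  obtain ⟨k, hk⟩ : ∃ k : ℝ, ((finrank ℝ E : ℝ) - 2) / 2 = k := ⟨_, rfl⟩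
  have hk0 : 0 < k := by
    have : (3 : ℝ) ≤ finrank ℝ E := by exact_mod_cast hn
    rw [← hk]; linarith
  -- the a-priori bound and the harmonic barrier, in terms of `k = (n-2)/2`
  have hbound : ∀ y : E, y ≠ a → u y ≤ (4 : ℝ) ^ k * ‖y - a‖ ^ (-k) := fun y hy => by
    have := hu.le_of_compl_singleton hn hy
    rwa [hk] at this
  set h : E → ℝ := fun y => (‖y - a‖ ^ 2) ^ (-k) with hh
  have hharm : ∀ y : E, y ≠ a → (Δ h) y = 0 := fun y hy => by
    have := laplacian_fundamental_eq_zero (E := E) hy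
    rwa [hk] at this
  have hhC2 : ∀ y : E, y ≠ a → ContDiffAt ℝ 2 h y := fun y hy => by
    have hy' : 0 < ‖y - a‖ ^ 2 := by
      have := norm_pos_iff.2 (sub_ne_zero.2 hy)
      positivity
    have h1 : ContDiffAt ℝ 2 (fun z : E => ‖z - a‖ ^ 2) y :=
      ((contDiff_norm_sq ℝ).comp (contDiff_id.sub contDiff_const)).contDiffAt
    exact h1.rpow_const_of_ne hy'.ne'
  have hhpos : ∀ y : E, y ≠ a → 0 < h y := fun y hy => by
    have := norm_pos_iff.2 (sub_ne_zero.2 hy)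
    exact Real.rpow_pos_of_pos (by positivity) _
  -- `h y = ‖y-a‖^(-k) * ‖y-a‖^(-k)`
  have hhval : ∀ y : E, h y = ‖y - a‖ ^ (-k) * ‖y - a‖ ^ (-k) := fun y => by
    simp only [hh]
    rw [sq, Real.mul_rpow (norm_nonneg _) (norm_nonneg _)]
  have hC : 0 < (4 : ℝ) ^ k := Real.rpow_pos_of_pos (by norm_num) _
  have hd : 0 < ‖x - a‖ := norm_pos_iff.2 (sub_ne_zero.2 hxa)
  -- Main estimate: `u x ≤ ε h x + δ` for all `ε, δ > 0`
  have key : ∀ ε δ : ℝ, 0 < ε → 0 < δ → u x ≤ ε * h x + δ := by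
    intro ε δ hε hδ
    -- inner radius `ρ`: `4^k ρ^k < ε` and `0 < ρ < ‖x - a‖`
    have hlim0 : Tendsto (fun ρ : ℝ => (4 : ℝ) ^ k * ρ ^ k) (𝓝[>] 0) (𝓝 0) := by
      have h1 : Tendsto (fun ρ : ℝ => ρ ^ k) (𝓝 (0 : ℝ)) (𝓝 0) := by
        have := (Real.continuousAt_rpow_const 0 k (Or.inr hk0.le)).tendsto
        simpa [Real.zero_rpow hk0.ne'] using this
      simpa using (h1.mono_left nhdsWithin_le_nhds).const_mul ((4 : ℝ) ^ k)
    obtain ⟨ρ, ⟨hρε, hρx⟩, hρ0⟩ :=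
      ((((hlim0.eventually (Iio_mem_nhds hε))).and
        (mem_nhdsWithin_of_mem_nhds (Iio_mem_nhds hd))).and self_mem_nhdsWithin).exists
    have hρ0 : 0 < ρ := hρ0
    have hρε : (4 : ℝ) ^ k * ρ ^ k < ε := hρε
    have hρx : ρ < ‖x - a‖ := hρx
    -- outer radius `R'`: `4^k R'^(-k) < δ` and `‖x - a‖ < R'`
    have hlim1 : Tendsto (fun r : ℝ => (4 : ℝ) ^ k * r ^ (-k)) atTop (𝓝 0) := by
      simpa using (tendsto_rpow_neg_atTop hk0).const_mul ((4 : ℝ) ^ k)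
    obtain ⟨R', hR'δ, hR'x⟩ :=
      ((hlim1.eventually (Iio_mem_nhds hδ)).and (eventually_gt_atTop ‖x - a‖)).exists
    have hR'δ : (4 : ℝ) ^ k * R' ^ (-k) < δ := hR'δ
    -- the compact annulus `A` and its interior `V`
    set A : Set E := {y | ρ ≤ ‖y - a‖ ∧ ‖y - a‖ ≤ R'} with hA
    set V : Set E := {y | ρ < ‖y - a‖ ∧ ‖y - a‖ < R'} with hV
    have hnc : Continuous fun y : E => ‖y - a‖ := by fun_prop
    have hAc : IsCompact A := isCompact_annulus a ρ R'
    have hVo : IsOpen V :=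
      (isOpen_lt continuous_const hnc).inter (isOpen_lt hnc continuous_const)
    have hVA : V ⊆ A := fun y hy => ⟨hy.1.le, hy.2.le⟩
    have hAa : ∀ y ∈ A, y ≠ a := by
      intro y hy hya
      have h1 : ρ ≤ ‖y - a‖ := hy.1
      rw [hya, sub_self, norm_zero] at h1
      linarith
    have hxA : x ∈ A := ⟨hρx.le, hR'x.le⟩
    -- `w = u - ε h - δ` attains its max over `A`
    set w : E → ℝ := (u - ε • h) - fun _ => δ with hw
    have hwval : ∀ y, w y = u y - ε * h y - δ := fun y => by
      simp [hw]
    have hwc : ContinuousOn w A := by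
      refine ((hu.contDiffOn.continuousOn.mono fun y hy => hAa y hy).sub
        (ContinuousOn.const_smul (fun y hy => (hhC2 y (hAa y hy)).continuousAt.continuousWithinAt)
          ε)).sub continuousOn_const
    obtain ⟨x₀, hx₀A, hmax⟩ := hAc.exists_isMaxOn ⟨x, hxA⟩ hwc
    by_contra hlt
    have hwx : 0 < w x := by rw [hwval]; linarith [not_le.1 hlt]
    have hw0 : 0 < w x₀ := hwx.trans_le (hmax hxA)
    have hx₀a : x₀ ≠ a := hAa x₀ hx₀A
    have hux₀ : ε * h x₀ + δ < u x₀ := by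
      have := hwval x₀
      linarith
    have hupos : 0 < u x₀ := by
      have := mul_pos hε (hhpos x₀ hx₀a)
      linarith
    have hnorm₀ : 0 < ‖x₀ - a‖ := norm_pos_iff.2 (sub_ne_zero.2 hx₀a)
    -- `x₀` is not on the inner sphere
    have hinner : ρ < ‖x₀ - a‖ := by
      rcases hx₀A.1.lt_or_eq with hlt' | heq
      · exact hlt'
      · exfalso
        have hb := hbound x₀ hx₀a
        rw [← heq] at hb
        -- `4^k ρ^(-k) < ε h x₀ = ε ρ^(-k) ρ^(-k)`
        have hρk : 0 < ρ ^ (-k) := Real.rpow_pos_of_pos hρ0 _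
        have hone : ρ ^ k * ρ ^ (-k) = 1 := by
          rw [Real.rpow_neg hρ0.le, mul_inv_cancel₀ (Real.rpow_pos_of_pos hρ0 _).ne']
        have h1 : (4 : ℝ) ^ k * ρ ^ (-k) < ε * (ρ ^ (-k) * ρ ^ (-k)) := by
          have h2 : (4 : ℝ) ^ k * ρ ^ k * ρ ^ (-k) < ε * ρ ^ (-k) :=
            mul_lt_mul_of_pos_right hρε hρk
          calc (4 : ℝ) ^ k * ρ ^ (-k) = (4 : ℝ) ^ k * ρ ^ (-k) * (ρ ^ k * ρ ^ (-k)) := by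
                rw [hone, mul_one]
            _ = (4 : ℝ) ^ k * ρ ^ k * ρ ^ (-k) * ρ ^ (-k) := by ring
            _ < ε * ρ ^ (-k) * ρ ^ (-k) := mul_lt_mul_of_pos_right h2 hρk
            _ = ε * (ρ ^ (-k) * ρ ^ (-k)) := by ring
        have h3 : h x₀ = ρ ^ (-k) * ρ ^ (-k) := by rw [hhval x₀, ← heq]
        rw [← h3] at h1
        linarith
    -- `x₀` is not on the outer sphere
    have houter : ‖x₀ - a‖ < R' := by
      rcases hx₀A.2.lt_or_eq with hlt' | heq
      · exact hlt'
      · exfalso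
        have hb := hbound x₀ hx₀a
        rw [heq] at hb
        have := mul_pos hε (hhpos x₀ hx₀a)
        linarith
    -- interior local maximum of a `C²` function with positive Laplacian: contradiction
    have hx₀V : x₀ ∈ V := ⟨hinner, houter⟩
    have hlocal : IsLocalMax w x₀ := hmax.isLocalMax (mem_of_superset (hVo.mem_nhds hx₀V) hVA)
    have hu2 : ContDiffAt ℝ 2 u x₀ :=
      hu.contDiffOn.contDiffAt (isOpen_compl_singleton.mem_nhds hx₀a)
    have hεh2 : ContDiffAt ℝ 2 (ε • h) x₀ := (hhC2 x₀ hx₀a).const_smul ε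
    have husub : ContDiffAt ℝ 2 (u - ε • h) x₀ := hu2.sub hεh2
    have hconst : ContDiffAt ℝ 2 (fun _ : E => δ) x₀ := contDiffAt_const
    have hΔle : (Δ w) x₀ ≤ 0 :=
      laplacian_nonpos_of_isLocalMax hlocal (husub.sub hconst)
    have hΔ : (Δ w) x₀ = nonlinearity (finrank ℝ E) (u x₀) := by
      rw [hw, husub.laplacian_sub hconst, hu2.laplacian_sub hεh2,
        InnerProductSpace.laplacian_smul _ (hhC2 x₀ hx₀a), hharm x₀ hx₀a, hu.laplacian_eq hx₀a]
      simp
    have hpos : 0 < nonlinearity (finrank ℝ E) (u x₀) := nonlinearity_pos hn hupos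
    linarith
  -- `ε, δ → 0`
  have hle : u x ≤ 0 := by
    refine le_of_forall_pos_le_add fun η hη => ?_
    have hhx : 0 < h x := hhpos x hxa
    have := key (η / 2 / h x) (η / 2) (by positivity) (by positivity)
    have hcalc : η / 2 / h x * h x = η / 2 := by field_simp
    linarith
  exact le_antisymm hle (hu.nonneg hx)

end LiouvilleProof

/-- **LN4 (punctured space), unconditional**: `u_{ℝⁿ ∖ {a}} ≡ 0` for `n ≥ 3`.
[cite: GonzalezLiNguyen2018, §1 p. 4] -/
theorem loewnerNirenberg_compl_singleton' (hn : 3 ≤ finrank ℝ E) (a x : E) :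
    loewnerNirenberg ({a}ᶜ : Set E) x = 0 :=
  loewnerNirenberg_compl_singleton punctured_space_liouville_holds hn a x

/-- **LN4 (whole space), unconditional**: `u_{ℝⁿ} ≡ 0` for `n ≥ 3`.
[cite: GonzalezLiNguyen2018, §1 p. 4] -/
theorem loewnerNirenberg_univ' (hn : 3 ≤ finrank ℝ E) (x : E) :
    loewnerNirenberg (univ : Set E) x = 0 :=
  loewnerNirenberg_univ punctured_space_liouville_holds hn x

end LoewnerNirenberg

end Literature.Analysis.PDE
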